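import Summits.FinalStateConjecture.FinalStateConjecture.Theses.RenormalisedDrift
import HarnessLib
import Summits.FinalStateConjecture.FinalStateConjecture.Theorems.RenormalisedDriftDriftCaptureStubGlobalGauge
import Summits.FinalStateConjecture.FinalStateConjecture.Theorems.RenormalisedDriftDriftCaptureGlobalGaugePacking
import Summits.FinalStateConjecture.FinalStateConjecture.Theorems.RenormalisedDriftDriftCaptureFreezeFragments
import Summits.FinalStateConjecture.FinalStateConjecture.Theorems.RenormalisedDriftDriftCapturePinnedOfSettle
import Summits.FinalStateConjecture.FinalStateConjecture.Theorems.RenormalisedDriftDriftCaptureOrthochronousRelabel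
import Summits.FinalStateConjecture.FinalStateConjecture.Theorems.RenormalisedDriftDriftCapturePinnedOfCauchyChain
import Summits.FinalStateConjecture.FinalStateConjecture.Theorems.RenormalisedDriftDriftCaptureUnflooredRadii
import Summits.FinalStateConjecture.FinalStateConjecture.Theorems.PhotonSphereChannelsEndVisibleOuterRegion
import Summits.FinalStateConjecture.FinalStateConjecture.Theorems.RenormalisedDriftDriftCaptureFlatChartOrientation
import Summits.FinalStateConjecture.FinalStateConjecture.Theorems.RenormalisedDriftDriftCapturePinSameChain

/-!
# Birth skeleton v6–v10 — crux stmt-FinalStateConjecture-17391 `Theses.RenormalisedDrift.DriftCapture` (rank 2)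
# line `birth` / `registered` (continuation leads prover-line-stmt-FinalStateConjecture-17391-c1-0 (v6–v8), -c2-0 (v9), -c3-0 (v10), 2026-08-17)

v10 (lead c3, 2026-08-17, after wave 1 of this lead: p165980 p166771 p166114 p166096 p166194 p167385). THREE changes, all driven by
landed theorems or typed worker audits; CENSOR-S / CENSOR-N and everything below the seam are byte-identical to v9.
(1) FLAT LOSES ITS ORIENTATION CLAUSE: the registered `N = 0` stub is now `stub_flatChartOfTrackingUnoriented` (four clauses:
half-space domain, late chart into its self-determined exterior, `C²`-deviation `→ 0`, uncharted part below every slab); the v3–v9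
five-clause `stub_flatLateChartOfTracking` is DERIVED in-file by the landed `stub_flatLateChartOfTracking_of_unoriented` (p165980:
`Φ_* ∂₀` eventually future-directed is automatic for an anchored convergent flat chart of a maximal development — non-imprisonment,
sister crux RecurrentlyFlatDisperses `stub_chartFuture`/`stub_anchorCone`, applied to the chart restarted at an anchor time).
So the `N = 0` ASSEMBLE target of DriftCapture and the convergent anchored chart of crux stmt-14665 (its open half (B)) are ONE object.
(2) THE ENGINE→GLUE SEAM CARRIES THREE MORE CLAUSES that the engine's construction gives for free and that the gluing otherwise must
re-derive from rigidity (worker GLUE audit, `work/missing/stub_glueSharpChain_missing.lean`: unoriented near-zone rigidity is FALSE —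
Kerr's discrete isometry `β` is not affine in ingoing Kerr–Schild coordinates — so hole-chart forwardness is a genuine hypothesis of
(G1K); abutting windows give only a start LEAF as overlap): (k) FAT CHAINING `certifiedSlab σ (cₙ₊₁) ⊆ windowImage cₙ` for all
`σ ∈ [0, 1/2]` (consecutive windows overlap on a slab of positive thickness, not on a leaf), (l) FORWARD HOLE CHARTS (the push-forward of
`Λᵢ V_{Mᵢ,aᵢ}` under every hole chart is future-directed on its truncated window — the window form of `IsFutureOriented` (ii)), (m) FORWARD
FLAT CHARTS (`Φ_* ∂₀` future-directed on the flat window — the window form of `IsFutureOriented` (iii)). New registered stubs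
`stub_forwardSharpChain` (engine: all-accuracy tracking ⇒ ONE sharpening chain with clauses (a)–(h), (k), (l), (m) and Cauchy labels)
and `stub_glueForwardChain` (gluing from such a chain, pinned; conclusion = the twelve floor-free packaging clauses, unchanged); the v9
`stub_sharpTrackingChain` is DERIVED in-file from the new engine stub (forget (k)(l)(m)), and the v9 gluing statement implies the new one
(`glueForwardChain_of_glueSharpChain`, so the typed v9 reduction `stub_glueSharpChain_of_missing` of the worker composes). The extra
clauses cost the engine nothing on paper (its conclusion is existential; the renormalised bootstrap lays down its own windows in a
future-directed gauge with overlapping slow steps) and delete (G2-orientation) `HoleChartsEventuallyForward` from the gluing's debts,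
leaving (G1) `SeamRigidityFlat` (M), (G1K) `SeamRigidityKerr` (L) and (G0+G3) `RecedingAssembly` (XL) — typed in the missing-facts file.
(3) THE PIN IS STATED FOR THE SAME CHAIN: `exists_pinned_of_cauchyLabels` (landed p167385, registered sub-goal; Cauchy labels ⇒
eventually pinned at a box point with Lorentz boosts, for THE GIVEN family, no chain clause in the hypotheses) replaces the existential
re-packaging `stub_pinnedOfCauchyChain` (p157120, kept for the v9 legend), so that (k)(l)(m) ride through the pin untouched (imported).
Composition `DriftCapture_of_v10 : forward engine → FLAT (unoriented) → GLUE (forward chain) → CENSOR-S → CENSOR-N → DriftCapture`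
(kernel-checked, no `sorry` of its own); `driftCapture_of_stubs` concludes the route decl BY NAME from the v10 registered stubs
`stub_forwardSharpChain`, `stub_flatChartOfTrackingUnoriented`, `stub_glueForwardChain`, `stub_chartsShadowEndVisibleRegion`,
`stub_noHiddenCompleteRays`. Other landings of this lead's wave (all `--supports` 17391): p166114 GlueTailPinning (every tail of a chain pins
the same exterior; points of `O` eventually below the start slabs), p166096 CensorSRayRecurrence (`FarRaysShadowedBy ↔` far complete rays
recur to `closure I⁻(C)`; `censorS_of_raysRecurCharted`: recurrence in `closure fd.charted` ⇒ S at `(𝒟, fd)`), p166194 CensorNNecessity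
((C) for any witness inside `closure endVisibleRegion` ⇒ N; a hidden complete ray defeats (C) for every end-visible witness),
p166771 FlatChartConverse (0-hole honest decomposition ⇒ the five-clause chart; the FLAT conclusion holds in the Lean Minkowski development).

History before v10 follows.

History. v1 (planner, 3 stubs FREEZE / ASSEMBLE / CENSOR) → v2–v3 (lead c0: ASSEMBLE peeled along the landed packaging
theorems p147895 / p148929 / p151942, FREEZE fragments p150050; verdict `promote-stub: stub_parametersFreeze`) → v4/v5 (this
lead: FREEZE split into `stub_labelsSettle` (physics: per accuracy an eventually δ-steady chain with bounded boosts) +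
`stub_pinnedOfSettle` (formal Bolzano–Weierstrass, LANDED p155010; converse p155383); seam = eventual pinning at `L = 1`)
→ v6 (this file): the seam is ONE SHARPENING CHAIN.

Why v6. A per-accuracy family of chains (v4/v5) is neither what the route's engine produces nor what the gluing wants: the
renormalised bootstrap (card K2: GKS/DHRT re-anchored on slow steps, first-law budget) outputs ONE chain of windows — the slow
steps — read at the accuracy the decaying radiation dictates, `εₙ → 0`, with labels re-anchored by summable increments; and a
gluing fed with mutually unrelated chains (one per accuracy, each with its own self-determined region `O`) must first identify
them across accuracies (restart + cross-chain rigidity), whereas ONE chained sequence of windows with `εₙ → 0` needs only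
consecutive-window transition maps. So:

* `stub_sharpTrackingChain` (FREEZE core = the engine, physics): on the live range `0 < N`, `m₀ ≤ 1`, all-accuracy tracking ⇒
  ONE chain `n ↦ cₙ` of `εₙ`-approximate `N`-Kerr configurations on chart-time windows `[0, 1]` of their own charts with
  `εₙ → 0`, near-zone radii `Rₙ → ∞`, `N` holes with labels in the box, chained start slabs, exhaustion of every compact past,
  `O = J⁺(ι X) ∩ I⁻(⋃ windows)` covered by `J⁻(first slab) ∪ ⋃ windows`, and CAUCHY labels: for every `δ > 0`, from some window on,
  any two windows' labels `(Mᵢ, aᵢ, Λᵢ)` agree within `δ` (masses, spins, boosts in operator norm). Exactly "parameters stop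
  wandering along the slow steps" — the first-law budget `Σₙ |δλₙ| < ∞` in finite form; no limit is named.
* `stub_pinnedOfCauchyChain` (FREEZE bookkeeping, FORMAL; v7: LANDED p157120 and derived in-file by name): Cauchy labels along one chain ⇒ ONE point
  `(M, a, Λ)` of the moduli space (box, `Λⱼ ∈ O(1,3)`) at which the same chain is eventually `δ`-pinned for every `δ`
  (completeness of the finite-dimensional label space; closedness of the box and of `O(1,3)`, `isClosed_labelSet` /
  `exists_lorentzGroup_coe_eq` of p155010).
* `stub_glueSharpChain` (ASSEMBLE gluing, `0 < N`, `m₀ ≤ 1`; v8 name, v6/v7 `stub_lateChartsOfSharpChain` minus the radius floor):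
  ONE sharpening chain of windows of length `1`, eventually pinned at `(M, a, Λ)`, ⇒ `N + 1` late charts with TWELVE packaging
  clauses — the thirteen of `decomposition_of_lateCharts` (p151942) minus orthochronicity of the motions (manufactured by Poincaré
  relabelling: `decomposition_of_unorientedLateCharts`, p156248, wave-1 worker) and with the honest-radius FLOOR `Rᵢ(τ) ≥ max(r₊,0)+1`
  deleted from clause 8 (manufactured by `R' := max R floor`: `decomposition_of_unflooredLateCharts`, p158178, wave-2 worker). It is the
  route's foreseen RecedingAssembly (dynamics: asymptotically free motion of the holes, far-field frame) + near-zone chart gluing. Content: (G1) near-isometry rigidity of truncated Kerr / flat slabs for CONSECUTIVE,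
  CHAINED windows, (G2) causal geometry of window images (chart time vs causal order on entire slabs, the late region of ONE `O`,
  time orientation from chaining + exhaustion — the configuration structure is blind to `Λ ↦ Λ·T`), (G3) patching with drifts
  absorbed into chart maps / `o(t)` excision radii. XL, no tree API.
* `stub_flatLateChartOfTracking` (ASSEMBLE, `N = 0`) and `stub_settledExteriorHoldsRays` (CENSOR = item stmt-FinalStateConjecture-17673
  verbatim) are UNCHANGED (registered signatures of v3–v5). For `N = 0` there are no labels and no engine; the cross-accuracy
  gluing stays inside the flat stub (its seam unfolded by the landed `allAccuracy_zero_iff_flatWindows`, p155614, wave-1 worker).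

`DriftCapture_of` (kernel-checked, no `sorry` of its own): `N = 0` — flat stub + landed `globalGauge_zero_of_flatLateChart`
(p148929); `0 < N ∧ 1 < m₀` — hypothesis unsatisfiable (landed `not_isAdiabaticallyTracked_of_one_lt`, p150050); `0 < N ∧ m₀ ≤ 1` —
sharp chain → pin → glue → `decomposition_of_unflooredLateCharts` (p158178 ∘ p156248 ∘ p151942) → sub-extremality from the margin `|aⱼ| ≤ χ Mⱼ < Mⱼ` → CENSOR.
Disproof used: none exists (`ledger crux ls`: no `Disproof.lean`, no `Negative/*`, no `*.dead.md`). All stub signatures are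
DEF-FREE; `Sig.*` are legend only. The v4/v5 stubs `stub_labelsSettle` / `stub_lateChartsOfPinnedTracking` are retired by this
reshape (their landed supports p155010 / p155383 / p156248 stay on the item; `lateChartsOfPinnedTracking_of_unoriented` records that
the v5 gluing stub, too, could drop orthochronicity).

v9 (lead c2, 2026-08-17): CENSOR SPLIT ALONG END-VISIBILITY. The v1–v8 CENSOR stub was the shared item
stmt-FinalStateConjecture-17673 `SettledExteriorHoldsRays` verbatim — a ∀-decomposition statement whose own registered skeleton
(`Cruxes/SettledExteriorHoldsRays/Lines/birth.lean`) cuts it into S = `stub_chartsShadowEndVisibleRegion` (chart side: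
`endVisibleRegion 𝒟 ∩ J⁺(ιX) ⊆ exteriorOf 𝒟 fd.charted`, size L) and N = `stub_noHiddenCompleteRays` (interior side:
`EndVisible.CompleteRaysNearEndVisible 𝒟`, no future-complete null ray from `Σ` hidden from the asymptotically flat end; size XL and
OPERATOR-CONTINGENT: summit ruling Q-F1 on clause (C) `RaysStayInClosure` versus hidden expanding vacuum pockets behind a neck,
`X = ℝ³ # H³/Γ`, cf. the retired route PocketUniverses and `Cruxes/PocketExists/STRATEGY-CENSUS.md`). v9 registers THESE TWO stubs
verbatim (by signature) in place of the monolithic CENSOR and derives `stub_settledExteriorHoldsRays` in-file from them with the landed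
`EndVisible` set API (`raysStayInClosure_of_outerRegion_subset_closure`, `outerRegion_subset_endVisibleRegion_of_completeRaysNearEndVisible`,
`Theorems/PhotonSphereChannelsEndVisible{Defs,OuterRegion}.lean`), so that (i) a landing of either half for 17673 (or for the sister
crux stmt-17430, whose line `Sketch` carries N verbatim-in-kind) closes the corresponding stub here by name and signature, (ii) the
operator-contingent interior content of DriftCapture is isolated in ONE stub (N) — if Q-F1 re-types clause (C) to end-visible rays
(`EndVisible.EndVisibleRaysStayInClosure`), N drops out of the summit and of this skeleton and CENSOR = S alone — and (iii) the
finding of this cycle is recorded where the disprover reads it: for pocketed data tracked at every accuracy in the AF exterior NO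
honest witness `O′ ⊆ closure (true d.o.c.)` satisfies clause (C), so on such data the crux as typed is decided by N (report
`Lines/birth-lead-c3.md` §3). FREEZE / FLAT / GLUE stubs and the whole composition above CENSOR are byte-identical to v8.
-/

set_option linter.dupNamespace false

namespace Summit.FinalStateConjecture.FinalStateConjecture.Cruxes.DriftCapture.Birth

open scoped BigOperators Topology Manifold ENNReal ContDiff
open Filter Set Function TopologicalSpace
open Literature.Geometry.Lorentzian

/-! ## Legend: the stub statements as named propositions -/

/-- Statement of `stub_sharpTrackingChain` (FREEZE core = the engine: all-accuracy tracking ⇒ ONE sharpening chain of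
length-1 windows, `εₙ → 0`, `Rₙ → ∞`, with Cauchy labels). -/
def Sig.stub_sharpTrackingChain : Prop :=
  ∀ (N : ℕ) (m₀ χ : ℝ), 0 < N → m₀ ≤ 1 → 0 < m₀ → 0 ≤ χ → χ < 1 → ∀ (X : Type) [TopologicalSpace X] [ChartedSpace E3 X] [IsManifold (𝓡 3) ((⊤ : ℕ∞) : WithTop ℕ∞) X] [T2Space X] [SecondCountableTopology X] [ConnectedSpace X], ∀ D ∈ admissibleVacuumData X, ∀ 𝒟 : VacuumCauchyDevelopment D, 𝒟.IsMaximal → Summit.FinalStateConjecture.HasCompleteNullInfinity 𝒟.toCauchyDevelopment → (∀ (L : ℝ) (ε : ENNReal) (R₀ : ℝ), 0 < L → 0 < ε → 𝒟.IsAdiabaticallyTracked N m₀ χ ε L R₀) → ∃ (ε : ℕ → ENNReal) (R : ℕ → ℝ) (O : Set 𝒟.carrier) (c : ∀ n : ℕ, ApproximateKerrConfiguration 𝒟.toSpacetime O 2 (ε n) 0 1 (R n)), Tendsto ε atTop (𝓝 0) ∧ Tendsto R atTop atTop ∧ (∀ n, (c n).N = N) ∧ (∀ n (i : Fin (c n).N),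 m₀ ≤ (c n).mass i ∧ (c n).mass i ≤ m₀⁻¹ ∧ |(c n).spin i| ≤ χ * (c n).mass i) ∧ (∀ n, (c (n + 1)).certifiedSlab 0 ⊆ (c n).windowImage) ∧ (∀ K : Set 𝒟.carrier, IsCompact K → ∃ n₀ : ℕ, ∀ n, n₀ ≤ n → Disjoint (c n).windowImage (𝒟.metric.causalPast 𝒟.timeOrientation K)) ∧ O = 𝒟.toCauchyDevelopment.exteriorOf (⋃ n, (c n).windowImage) ∧ O ⊆ 𝒟.metric.causalPast 𝒟.timeOrientation ((c 0).certifiedSlab 0) ∪ ⋃ n, (c n).windowImage ∧ ∀ δ : ℝ, 0 < δ → ∃ n₀ : ℕ, ∀ n n' : ℕ, n₀ ≤ n → n₀ ≤ n' → ∀ (i : Fin (c n).N) (i' : Fin (c n').N), (i : ℕ) = (i' : ℕ) → |(c n).mass i - (c n').mass i'| ≤ δ ∧ |(c n).spin i - (c n').spin i'| ≤ δ ∧ ‖((((c n).motion i).1 : E4 ≃L[ℝ] E4) : E4 →L[ℝ] E4) - ((((c n').motion i').1 : E4 ≃L[ℝ] E4) : E4 →L[ℝ] E4)‖ ≤ 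δ

/-- Statement of `stub_pinnedOfCauchyChain` (FREEZE bookkeeping, formal: Cauchy labels along one chain ⇒ a limit point of
the moduli space at which the chain is eventually pinned). -/
def Sig.stub_pinnedOfCauchyChain : Prop :=
  ∀ {X : Type} [TopologicalSpace X] [ChartedSpace E3 X] [IsManifold (𝓡 3) ((⊤ : ℕ∞) : WithTop ℕ∞) X] [ConnectedSpace X] {D : InitialDataSet (𝓡 3) X} (𝒟 : VacuumCauchyDevelopment D) (N : ℕ) (m₀ χ : ℝ), (∃ (ε : ℕ → ENNReal) (R : ℕ → ℝ) (O : Set 𝒟.carrier) (c : ∀ n : ℕ, ApproximateKerrConfiguration 𝒟.toSpacetime O 2 (ε n) 0 1 (R n)), Tendsto ε atTop (𝓝 0) ∧ Tendsto R atTop atTop ∧ (∀ n, (c n).N = N) ∧ (∀ n (i : Fin (c n).N), m₀ ≤ (c n).mass i ∧ (c n).mass i ≤ m₀⁻¹ ∧ |(c n).spin i| ≤ χ * (c n).mass i) ∧ (∀ n, (c (n + 1)).certifiedSlab 0 ⊆ (c n).windowImage) ∧ (∀ K : Set 𝒟.carrier, IsCompact K → ∃ n₀ : ℕ, ∀ n,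 n₀ ≤ n → Disjoint (c n).windowImage (𝒟.metric.causalPast 𝒟.timeOrientation K)) ∧ O = 𝒟.toCauchyDevelopment.exteriorOf (⋃ n, (c n).windowImage) ∧ O ⊆ 𝒟.metric.causalPast 𝒟.timeOrientation ((c 0).certifiedSlab 0) ∪ ⋃ n, (c n).windowImage ∧ ∀ δ : ℝ, 0 < δ → ∃ n₀ : ℕ, ∀ n n' : ℕ, n₀ ≤ n → n₀ ≤ n' → ∀ (i : Fin (c n).N) (i' : Fin (c n').N), (i : ℕ) = (i' : ℕ) → |(c n).mass i - (c n').mass i'| ≤ δ ∧ |(c n).spin i - (c n').spin i'| ≤ δ ∧ ‖((((c n).motion i).1 : E4 ≃L[ℝ] E4) : E4 →L[ℝ] E4) - ((((c n').motion i').1 : E4 ≃L[ℝ] E4) : E4 →L[ℝ] E4)‖ ≤ δ) → ∃ (M a : Fin N → ℝ) (Λ : Fin N → lorentzGroup), (∀ j, m₀ ≤ M j ∧ M j ≤ m₀⁻¹ ∧ |a j| ≤ χ * M j) ∧ ∃ (ε : ℕ → ENNReal) (R : ℕ → ℝ) (O : Set 𝒟.carrier) (c : ∀ n : ℕ, ApproximateKerrConfiguration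 𝒟.toSpacetime O 2 (ε n) 0 1 (R n)), Tendsto ε atTop (𝓝 0) ∧ Tendsto R atTop atTop ∧ (∀ n, (c n).N = N) ∧ (∀ n (i : Fin (c n).N), m₀ ≤ (c n).mass i ∧ (c n).mass i ≤ m₀⁻¹ ∧ |(c n).spin i| ≤ χ * (c n).mass i) ∧ (∀ n, (c (n + 1)).certifiedSlab 0 ⊆ (c n).windowImage) ∧ (∀ K : Set 𝒟.carrier, IsCompact K → ∃ n₀ : ℕ, ∀ n, n₀ ≤ n → Disjoint (c n).windowImage (𝒟.metric.causalPast 𝒟.timeOrientation K)) ∧ O = 𝒟.toCauchyDevelopment.exteriorOf (⋃ n, (c n).windowImage) ∧ O ⊆ 𝒟.metric.causalPast 𝒟.timeOrientation ((c 0).certifiedSlab 0) ∪ ⋃ n, (c n).windowImage ∧ ∀ δ : ℝ, 0 < δ → ∃ n₀ : ℕ, ∀ n, n₀ ≤ n → ∀ (i : Fin (c n).N) (j : Fin N), (i : ℕ) = (j : ℕ) → |(c n).mass i - M j| ≤ δ ∧ |(c n).spin i - a j| ≤ δ ∧ ‖((((c n).motion i).1 : E4 ≃L[ℝ] E4) :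 E4 →L[ℝ] E4) - (((Λ j : E4 ≃L[ℝ] E4)) : E4 →L[ℝ] E4)‖ ≤ δ

/-- Statement of `stub_flatLateChartOfTracking` (ASSEMBLE at `N = 0` in anchored-flat-chart form). UNCHANGED from v3. -/
def Sig.stub_flatLateChartOfTracking : Prop :=
  ∀ (m₀ χ : ℝ), 0 < m₀ → 0 ≤ χ → χ < 1 → ∀ (X : Type) [TopologicalSpace X] [ChartedSpace E3 X] [IsManifold (𝓡 3) ((⊤ : ℕ∞) : WithTop ℕ∞) X] [T2Space X] [SecondCountableTopology X] [ConnectedSpace X], ∀ D ∈ admissibleVacuumData X, ∀ 𝒟 : VacuumCauchyDevelopment D, 𝒟.IsMaximal → Summit.FinalStateConjecture.HasCompleteNullInfinity 𝒟.toCauchyDevelopment → (∀ (L : ℝ) (ε : ENNReal) (R₀ : ℝ), 0 < L → 0 < ε → 𝒟.IsAdiabaticallyTracked 0 m₀ χ ε L R₀) → ∃ (τ₁ : ℝ) (U₁ : TopologicalSpace.Opens E4) (Φ : U₁ → 𝒟.carrier), {x : E4 | τ₁ < x 0} ⊆ (U₁ : Set E4) ∧ 𝒟.toSpacetime.IsLateChart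 (Minkowski.backgroundOn U₁) (Summit.FinalStateConjecture.exteriorOf 𝒟.toCauchyDevelopment (Φ '' (Minkowski.backgroundOn U₁).lateRegion τ₁)) τ₁ Φ ∧ Tendsto (fun τ ↦ 𝒟.toSpacetime.deviationCk (Minkowski.backgroundOn U₁) Φ 2 τ) atTop (𝓝 0) ∧ (∀ τ : ℝ, τ₁ ≤ τ → Summit.FinalStateConjecture.exteriorOf 𝒟.toCauchyDevelopment (Φ '' (Minkowski.backgroundOn U₁).lateRegion τ₁) \ Φ '' (Minkowski.backgroundOn U₁).lateRegion τ ⊆ 𝒟.metric.causalPast 𝒟.timeOrientation (Φ '' (Minkowski.backgroundOn U₁).timeSlab τ)) ∧ ∀ᶠ τ in atTop, ∀ x ∈ (Minkowski.backgroundOn U₁).timeSlab τ, 𝒟.toSpacetime.timeOrientation.IsFutureDirected (mfderiv 𝓘(ℝ, E4) (𝓡 4) Φ x (E4.basisVector 0))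

/-- Statement of `stub_glueSharpChain` (ASSEMBLE's GLUING content on `0 < N`, `m₀ ≤ 1`: one sharpening chain
eventually pinned at `(M, a, Λ)` ⇒ `N + 1` late charts with the twelve floor-free packaging clauses of
`decomposition_of_unflooredLateCharts`). -/
def Sig.stub_glueSharpChain : Prop :=
  ∀ (N : ℕ) (m₀ χ : ℝ), 0 < N → m₀ ≤ 1 → 0 < m₀ → 0 ≤ χ → χ < 1 → ∀ (X : Type) [TopologicalSpace X] [ChartedSpace E3 X] [IsManifold (𝓡 3) ((⊤ : ℕ∞) : WithTop ℕ∞) X] [T2Space X] [SecondCountableTopology X] [ConnectedSpace X], ∀ D ∈ admissibleVacuumData X, ∀ 𝒟 : VacuumCauchyDevelopment D, 𝒟.IsMaximal → Summit.FinalStateConjecture.HasCompleteNullInfinity 𝒟.toCauchyDevelopment → ∀ (M a : Fin N → ℝ) (Λ : Fin N → lorentzGroup), (∀ j, m₀ ≤ M j ∧ M j ≤ m₀⁻¹ ∧ |a j| ≤ χ * M j) → (∃ (ε : ℕ → ENNReal) (R : ℕ → ℝ) (O : Set 𝒟.carrier) (c : ∀ n : ℕ, ApproximateKerrConfiguration 𝒟.toSpacetime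 O 2 (ε n) 0 1 (R n)), Tendsto ε atTop (𝓝 0) ∧ Tendsto R atTop atTop ∧ (∀ n, (c n).N = N) ∧ (∀ n (i : Fin (c n).N), m₀ ≤ (c n).mass i ∧ (c n).mass i ≤ m₀⁻¹ ∧ |(c n).spin i| ≤ χ * (c n).mass i) ∧ (∀ n, (c (n + 1)).certifiedSlab 0 ⊆ (c n).windowImage) ∧ (∀ K : Set 𝒟.carrier, IsCompact K → ∃ n₀ : ℕ, ∀ n, n₀ ≤ n → Disjoint (c n).windowImage (𝒟.metric.causalPast 𝒟.timeOrientation K)) ∧ O = 𝒟.toCauchyDevelopment.exteriorOf (⋃ n, (c n).windowImage) ∧ O ⊆ 𝒟.metric.causalPast 𝒟.timeOrientation ((c 0).certifiedSlab 0) ∪ ⋃ n, (c n).windowImage ∧ ∀ δ : ℝ, 0 < δ → ∃ n₀ : ℕ, ∀ n, n₀ ≤ n → ∀ (i : Fin (c n).N) (j : Fin N), (i : ℕ) = (j : ℕ) → |(c n).mass i - M j| ≤ δ ∧ |(c n).spin i - a j| ≤ δ ∧ ‖((((c n).motion i).1 : E4 ≃L[ℝ] E4) : E4 →L[ℝ]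 E4) - (((Λ j : E4 ≃L[ℝ] E4)) : E4 →L[ℝ] E4)‖ ≤ δ) → ∃ (O' : Set 𝒟.carrier) (mo : Fin N → lorentzGroup × E4) (τ₀ : ℝ) (Ψ : ∀ i, boostedKerrExterior (mo i).1 (mo i).2 (M i) (a i) → 𝒟.carrier) (ρ : Fin N → ℝ → ℝ) (U₀ : TopologicalSpace.Opens E4) (Φ : U₀ → 𝒟.carrier) (R : Fin N → ℝ → ℝ), O' = Summit.FinalStateConjecture.exteriorOf 𝒟.toCauchyDevelopment (Φ '' (Minkowski.backgroundOn U₀).lateRegion τ₀ ∪ ⋃ i, Ψ i '' (boostedKerrBackground (mo i).1 (mo i).2 (M i) (a i)).lateRegion τ₀) ∧ (∀ i, 𝒟.toSpacetime.IsLateChart (boostedKerrBackground (mo i).1 (mo i).2 (M i) (a i)) O' τ₀ (Ψ i)) ∧ (∀ r : ℝ, ∃ τ₁ : ℝ, Pairwise (Function.onFun Disjoint fun i ↦ Ψ i '' (boostedKerrBackground (mo i).1 (mo i).2 (M i) (a i)).truncLateRegion τ₁ r)) ∧ (∀ i, Tendsto (fun t ↦ ρ i t / t) atTop (𝓝 0))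 ∧ {x : E4 | τ₀ < x 0 ∧ ∀ i, ρ i (x 0) < Kerr.radius (a i) (poincareInv (mo i).1 (mo i).2 x)} ⊆ (U₀ : Set E4) ∧ 𝒟.toSpacetime.IsLateChart (Minkowski.backgroundOn U₀) O' τ₀ Φ ∧ Tendsto (fun τ ↦ 𝒟.toSpacetime.deviationCk (Minkowski.backgroundOn U₀) Φ 2 τ) atTop (𝓝 0) ∧ (∀ i, Tendsto (R i) atTop atTop) ∧ (∀ i, Tendsto (fun τ ↦ 𝒟.toSpacetime.truncDeviationCk (boostedKerrBackground (mo i).1 (mo i).2 (M i) (a i)) (Ψ i) 2 (R i τ) τ) atTop (𝓝 0)) ∧ (∀ τ₁ : ℝ, τ₀ ≤ τ₁ → O' \ (Φ '' (Minkowski.backgroundOn U₀).lateRegion τ₁ ∪ ⋃ i, Ψ i '' {x | τ₁ < (boostedKerrBackground (mo i).1 (mo i).2 (M i) (a i)).time x.1 ∧ (boostedKerrBackground (mo i).1 (mo i).2 (M i) (a i)).radius x.1 ≤ R i ((boostedKerrBackground (mo i).1 (mo i).2 (M i) (a i)).time x.1)}) ⊆ 𝒟.metric.causalPast 𝒟.timeOrientation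 (Φ '' (Minkowski.backgroundOn U₀).timeSlab τ₁ ∪ ⋃ i, Ψ i '' (boostedKerrBackground (mo i).1 (mo i).2 (M i) (a i)).truncTimeSlab (R i τ₁) τ₁)) ∧ (∀ i (r : ℝ), ∀ᶠ τ in atTop, ∀ x ∈ (boostedKerrBackground (mo i).1 (mo i).2 (M i) (a i)).truncTimeSlab r τ, 𝒟.toSpacetime.timeOrientation.IsFutureDirected (mfderiv 𝓘(ℝ, E4) (𝓡 4) (Ψ i) x (((mo i).1 : E4 ≃L[ℝ] E4) (Kerr.timeVector (M i) (a i) (poincareInv (mo i).1 (mo i).2 (x : E4)))))) ∧ ∀ᶠ τ in atTop, ∀ x ∈ (Minkowski.backgroundOn U₀).timeSlab τ, 𝒟.toSpacetime.timeOrientation.IsFutureDirected (mfderiv 𝓘(ℝ, E4) (𝓡 4) Φ x (E4.basisVector 0))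

/-- Statement of `stub_settledExteriorHoldsRays` (CENSOR: verbatim the shared item stmt-FinalStateConjecture-17673
`SettledExteriorHoldsRays`). UNCHANGED from v1–v5. -/
def Sig.stub_settledExteriorHoldsRays : Prop :=
  open Literature.Geometry.Lorentzian in open scoped ContDiff in ∀ (X : Type) [TopologicalSpace X] [ChartedSpace E3 X] [IsManifold (𝓡 3) ∞ X] [T2Space X] [SecondCountableTopology X] [ConnectedSpace X] (D : InitialDataSet (𝓡 3) X), D ∈ admissibleVacuumData X → ∀ 𝒟 : VacuumCauchyDevelopment D, 𝒟.IsMaximal → Summit.FinalStateConjecture.HasCompleteNullInfinity 𝒟.toCauchyDevelopment → ∀ (O : Set 𝒟.carrier) (fd : FinalStateDecomposition 𝒟.toSpacetime O 2), (∀ i, Kerr.IsSubextremal (fd.mass i) (fd.spin i)) → O = Summit.FinalStateConjecture.exteriorOf 𝒟.toCauchyDevelopment fd.charted → Summit.FinalStateConjecture.HasExhaustiveCharts fd → Summit.FinalStateConjecture.IsFutureOriented fd → Summit.FinalStateConjecture.RaysStayInClosure 𝒟.toCauchyDevelopment O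

/-- Statement of `stub_chartsShadowEndVisibleRegion` (CENSOR-S, v9; verbatim the registered stub S of crux
stmt-FinalStateConjecture-17673): for every honest exhaustive future-oriented sub-extremal decomposition of a censored MGHD of
admissible data, `endVisibleRegion 𝒟 ∩ J⁺(ιX) ⊆ exteriorOf 𝒟 fd.charted`. -/
def Sig.stub_chartsShadowEndVisibleRegion : Prop :=
  open Literature.Geometry.Lorentzian Summit.FinalStateConjecture.FinalStateConjecture.Theorems in open scoped Manifold ContDiff in ∀ (X : Type) [TopologicalSpace X] [ChartedSpace E3 X] [IsManifold (𝓡 3) ∞ X] [T2Space X] [SecondCountableTopology X] [ConnectedSpace X] (D : InitialDataSet (𝓡 3) X), D ∈ admissibleVacuumData X → ∀ 𝒟 : VacuumCauchyDevelopment D, 𝒟.IsMaximal → Summit.FinalStateConjecture.HasCompleteNullInfinity 𝒟.toCauchyDevelopment → ∀ (O : Set 𝒟.carrier) (fd : FinalStateDecomposition 𝒟.toSpacetime O 2), (∀ i, Kerr.IsSubextremal (fd.mass i) (fd.spin i)) → O = Summit.FinalStateConjecture.exteriorOf 𝒟.toCauchyDevelopment fd.charted → Summit.FinalStateConjecture.HasExhaustiveCharts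 fd → Summit.FinalStateConjecture.IsFutureOriented fd → ∀ [𝒟.metric.HasLeviCivita], EndVisible.endVisibleRegion 𝒟.toCauchyDevelopment ∩ 𝒟.metric.causalFuture 𝒟.timeOrientation (Set.range 𝒟.embed) ⊆ Summit.FinalStateConjecture.exteriorOf 𝒟.toCauchyDevelopment fd.charted

/-- Statement of `stub_noHiddenCompleteRays` (CENSOR-N, v9; verbatim the registered stub N of crux
stmt-FinalStateConjecture-17673): for every censored MGHD of admissible data admitting an honest exhaustive future-oriented
sub-extremal decomposition, `EndVisible.CompleteRaysNearEndVisible 𝒟`. -/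
def Sig.stub_noHiddenCompleteRays : Prop :=
  open Literature.Geometry.Lorentzian Summit.FinalStateConjecture.FinalStateConjecture.Theorems in open scoped Manifold ContDiff in ∀ (X : Type) [TopologicalSpace X] [ChartedSpace E3 X] [IsManifold (𝓡 3) ∞ X] [T2Space X] [SecondCountableTopology X] [ConnectedSpace X] (D : InitialDataSet (𝓡 3) X), D ∈ admissibleVacuumData X → ∀ 𝒟 : VacuumCauchyDevelopment D, 𝒟.IsMaximal → Summit.FinalStateConjecture.HasCompleteNullInfinity 𝒟.toCauchyDevelopment → ∀ (O : Set 𝒟.carrier) (fd : FinalStateDecomposition 𝒟.toSpacetime O 2), (∀ i, Kerr.IsSubextremal (fd.mass i) (fd.spin i)) → O = Summit.FinalStateConjecture.exteriorOf 𝒟.toCauchyDevelopment fd.charted → Summit.FinalStateConjecture.HasExhaustiveCharts fd → Summit.FinalStateConjecture.IsFutureOriented fd → EndVisible.CompleteRaysNearEndVisible 𝒟.toCauchyDevelopment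

/-- Statement of `stub_forwardSharpChain` (v10 engine: the v9 sharpening chain with, in addition, (k) fat chaining on `σ ∈ [0, 1/2]`,
(l) forward hole charts, (m) forward flat charts — inserted before the Cauchy-labels clause). -/
def Sig.stub_forwardSharpChain : Prop :=
  ∀ (N : ℕ) (m₀ χ : ℝ), 0 < N → m₀ ≤ 1 → 0 < m₀ → 0 ≤ χ → χ < 1 → ∀ (X : Type) [TopologicalSpace X] [ChartedSpace E3 X] [IsManifold (𝓡 3) ((⊤ : ℕ∞) : WithTop ℕ∞) X] [T2Space X] [SecondCountableTopology X] [ConnectedSpace X], ∀ D ∈ admissibleVacuumData X, ∀ 𝒟 : VacuumCauchyDevelopment D, 𝒟.IsMaximal → Summit.FinalStateConjecture.HasCompleteNullInfinity 𝒟.toCauchyDevelopment → (∀ (L : ℝ) (ε : ENNReal) (R₀ : ℝ), 0 < L → 0 < ε → 𝒟.IsAdiabaticallyTracked N m₀ χ ε L R₀) → ∃ (ε : ℕ → ENNReal) (R : ℕ → ℝ) (O : Set 𝒟.carrier) (c : ∀ n : ℕ, ApproximateKerrConfiguration 𝒟.toSpacetime O 2 (ε n) 0 1 (R n)), Tendsto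 ε atTop (𝓝 0) ∧ Tendsto R atTop atTop ∧ (∀ n, (c n).N = N) ∧ (∀ n (i : Fin (c n).N), m₀ ≤ (c n).mass i ∧ (c n).mass i ≤ m₀⁻¹ ∧ |(c n).spin i| ≤ χ * (c n).mass i) ∧ (∀ n, (c (n + 1)).certifiedSlab 0 ⊆ (c n).windowImage) ∧ (∀ K : Set 𝒟.carrier, IsCompact K → ∃ n₀ : ℕ, ∀ n, n₀ ≤ n → Disjoint (c n).windowImage (𝒟.metric.causalPast 𝒟.timeOrientation K)) ∧ O = 𝒟.toCauchyDevelopment.exteriorOf (⋃ n, (c n).windowImage) ∧ O ⊆ 𝒟.metric.causalPast 𝒟.timeOrientation ((c 0).certifiedSlab 0) ∪ ⋃ n, (c n).windowImage ∧ (∀ n, ∀ σ ∈ Set.Icc (0 : ℝ) (1 / 2), (c (n + 1)).certifiedSlab σ ⊆ (c n).windowImage) ∧ (∀ n (i : Fin (c n).N), ∀ x ∈ (boostedKerrBackground ((c n).motion i).1 ((c n).motion i).2 ((c n).mass i) ((c n).spin i)).truncWindow 0 1 (R n), 𝒟.toSpacetime.timeOrientation.IsFutureDirected (mfderiv 𝓘(ℝ,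 E4) (𝓡 4) ((c n).chart i) x ((((c n).motion i).1 : E4 ≃L[ℝ] E4) (Kerr.timeVector ((c n).mass i) ((c n).spin i) (poincareInv ((c n).motion i).1 ((c n).motion i).2 (x : E4)))))) ∧ (∀ n, ∀ x ∈ (Minkowski.backgroundOn (c n).flatDomain).window 0 1, 𝒟.toSpacetime.timeOrientation.IsFutureDirected (mfderiv 𝓘(ℝ, E4) (𝓡 4) (c n).flatChart x (E4.basisVector 0))) ∧ ∀ δ : ℝ, 0 < δ → ∃ n₀ : ℕ, ∀ n n' : ℕ, n₀ ≤ n → n₀ ≤ n' → ∀ (i : Fin (c n).N) (i' : Fin (c n').N), (i : ℕ) = (i' : ℕ) → |(c n).mass i - (c n').mass i'| ≤ δ ∧ |(c n).spin i - (c n').spin i'| ≤ δ ∧ ‖((((c n).motion i).1 : E4 ≃L[ℝ] E4) : E4 →L[ℝ] E4) - ((((c n').motion i').1 : E4 ≃L[ℝ] E4) : E4 →L[ℝ] E4)‖ ≤ δ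

/-- Statement of `stub_flatChartOfTrackingUnoriented` (v10 FLAT: the v3–v9 `stub_flatLateChartOfTracking` with its fifth clause
(`Φ_* ∂₀` eventually future-directed) deleted — verbatim the hypothesis of the landed `stub_flatLateChartOfTracking_of_unoriented`). -/
def Sig.stub_flatChartOfTrackingUnoriented : Prop :=
  ∀ (m₀ χ : ℝ), 0 < m₀ → 0 ≤ χ → χ < 1 → ∀ (X : Type) [TopologicalSpace X] [ChartedSpace E3 X] [IsManifold (𝓡 3) ((⊤ : ℕ∞) : WithTop ℕ∞) X] [T2Space X] [SecondCountableTopology X] [ConnectedSpace X], ∀ D ∈ admissibleVacuumData X, ∀ 𝒟 : VacuumCauchyDevelopment D, 𝒟.IsMaximal → Summit.FinalStateConjecture.HasCompleteNullInfinity 𝒟.toCauchyDevelopment → (∀ (L : ℝ) (ε : ENNReal) (R₀ : ℝ), 0 < L → 0 < ε → 𝒟.IsAdiabaticallyTracked 0 m₀ χ ε L R₀) → ∃ (τ₁ : ℝ) (U₁ : TopologicalSpace.Opens E4) (Φ : U₁ → 𝒟.carrier), {x : E4 | τ₁ < x 0} ⊆ (U₁ : Set E4) ∧ 𝒟.toSpacetime.IsLateChart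 (Minkowski.backgroundOn U₁) (Summit.FinalStateConjecture.exteriorOf 𝒟.toCauchyDevelopment (Φ '' (Minkowski.backgroundOn U₁).lateRegion τ₁)) τ₁ Φ ∧ Tendsto (fun τ ↦ 𝒟.toSpacetime.deviationCk (Minkowski.backgroundOn U₁) Φ 2 τ) atTop (𝓝 0) ∧ (∀ τ : ℝ, τ₁ ≤ τ → Summit.FinalStateConjecture.exteriorOf 𝒟.toCauchyDevelopment (Φ '' (Minkowski.backgroundOn U₁).lateRegion τ₁) \ Φ '' (Minkowski.backgroundOn U₁).lateRegion τ ⊆ 𝒟.metric.causalPast 𝒟.timeOrientation (Φ '' (Minkowski.backgroundOn U₁).timeSlab τ))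

/-- Statement of `stub_glueForwardChain` (v10 GLUE: hypothesis = ONE sharpening chain with clauses (a)–(h), (k), (l), (m), eventually
pinned at `(M, a, Λ)`; conclusion = the twelve floor-free packaging clauses of `decomposition_of_unflooredLateCharts`, as in v9). -/
def Sig.stub_glueForwardChain : Prop :=
  ∀ (N : ℕ) (m₀ χ : ℝ), 0 < N → m₀ ≤ 1 → 0 < m₀ → 0 ≤ χ → χ < 1 → ∀ (X : Type) [TopologicalSpace X] [ChartedSpace E3 X] [IsManifold (𝓡 3) ((⊤ : ℕ∞) : WithTop ℕ∞) X] [T2Space X] [SecondCountableTopology X] [ConnectedSpace X], ∀ D ∈ admissibleVacuumData X, ∀ 𝒟 : VacuumCauchyDevelopment D, 𝒟.IsMaximal → Summit.FinalStateConjecture.HasCompleteNullInfinity 𝒟.toCauchyDevelopment → ∀ (M a : Fin N → ℝ) (Λ : Fin N → lorentzGroup), (∀ j, m₀ ≤ M j ∧ M j ≤ m₀⁻¹ ∧ |a j| ≤ χ * M j) → (∃ (ε : ℕ → ENNReal) (R : ℕ → ℝ) (O : Set 𝒟.carrier) (c : ∀ n : ℕ, ApproximateKerrConfiguration 𝒟.toSpacetime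 O 2 (ε n) 0 1 (R n)), Tendsto ε atTop (𝓝 0) ∧ Tendsto R atTop atTop ∧ (∀ n, (c n).N = N) ∧ (∀ n (i : Fin (c n).N), m₀ ≤ (c n).mass i ∧ (c n).mass i ≤ m₀⁻¹ ∧ |(c n).spin i| ≤ χ * (c n).mass i) ∧ (∀ n, (c (n + 1)).certifiedSlab 0 ⊆ (c n).windowImage) ∧ (∀ K : Set 𝒟.carrier, IsCompact K → ∃ n₀ : ℕ, ∀ n, n₀ ≤ n → Disjoint (c n).windowImage (𝒟.metric.causalPast 𝒟.timeOrientation K)) ∧ O = 𝒟.toCauchyDevelopment.exteriorOf (⋃ n, (c n).windowImage) ∧ O ⊆ 𝒟.metric.causalPast 𝒟.timeOrientation ((c 0).certifiedSlab 0) ∪ ⋃ n, (c n).windowImage ∧ (∀ n, ∀ σ ∈ Set.Icc (0 : ℝ) (1 / 2), (c (n + 1)).certifiedSlab σ ⊆ (c n).windowImage) ∧ (∀ n (i : Fin (c n).N), ∀ x ∈ (boostedKerrBackground ((c n).motion i).1 ((c n).motion i).2 ((c n).mass i) ((c n).spin i)).truncWindow 0 1 (R n), 𝒟.toSpacetime.timeOrientation.IsFutureDirected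 (mfderiv 𝓘(ℝ, E4) (𝓡 4) ((c n).chart i) x ((((c n).motion i).1 : E4 ≃L[ℝ] E4) (Kerr.timeVector ((c n).mass i) ((c n).spin i) (poincareInv ((c n).motion i).1 ((c n).motion i).2 (x : E4)))))) ∧ (∀ n, ∀ x ∈ (Minkowski.backgroundOn (c n).flatDomain).window 0 1, 𝒟.toSpacetime.timeOrientation.IsFutureDirected (mfderiv 𝓘(ℝ, E4) (𝓡 4) (c n).flatChart x (E4.basisVector 0))) ∧ ∀ δ : ℝ, 0 < δ → ∃ n₀ : ℕ, ∀ n, n₀ ≤ n → ∀ (i : Fin (c n).N) (j : Fin N), (i : ℕ) = (j : ℕ) → |(c n).mass i - M j| ≤ δ ∧ |(c n).spin i - a j| ≤ δ ∧ ‖((((c n).motion i).1 : E4 ≃L[ℝ] E4) : E4 →L[ℝ] E4) - (((Λ j : E4 ≃L[ℝ] E4)) : E4 →L[ℝ] E4)‖ ≤ δ) → ∃ (O' : Set 𝒟.carrier) (mo : Fin N → lorentzGroup × E4) (τ₀ : ℝ) (Ψ : ∀ i, boostedKerrExterior (mo i).1 (mo i).2 (M i) (a i) → 𝒟.carrier)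 (ρ : Fin N → ℝ → ℝ) (U₀ : TopologicalSpace.Opens E4) (Φ : U₀ → 𝒟.carrier) (R : Fin N → ℝ → ℝ), O' = Summit.FinalStateConjecture.exteriorOf 𝒟.toCauchyDevelopment (Φ '' (Minkowski.backgroundOn U₀).lateRegion τ₀ ∪ ⋃ i, Ψ i '' (boostedKerrBackground (mo i).1 (mo i).2 (M i) (a i)).lateRegion τ₀) ∧ (∀ i, 𝒟.toSpacetime.IsLateChart (boostedKerrBackground (mo i).1 (mo i).2 (M i) (a i)) O' τ₀ (Ψ i)) ∧ (∀ r : ℝ, ∃ τ₁ : ℝ, Pairwise (Function.onFun Disjoint fun i ↦ Ψ i '' (boostedKerrBackground (mo i).1 (mo i).2 (M i) (a i)).truncLateRegion τ₁ r)) ∧ (∀ i, Tendsto (fun t ↦ ρ i t / t) atTop (𝓝 0)) ∧ {x : E4 | τ₀ < x 0 ∧ ∀ i, ρ i (x 0) < Kerr.radius (a i) (poincareInv (mo i).1 (mo i).2 x)} ⊆ (U₀ : Set E4) ∧ 𝒟.toSpacetime.IsLateChart (Minkowski.backgroundOn U₀) O' τ₀ Φ ∧ Tendsto (fun τ ↦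 𝒟.toSpacetime.deviationCk (Minkowski.backgroundOn U₀) Φ 2 τ) atTop (𝓝 0) ∧ (∀ i, Tendsto (R i) atTop atTop) ∧ (∀ i, Tendsto (fun τ ↦ 𝒟.toSpacetime.truncDeviationCk (boostedKerrBackground (mo i).1 (mo i).2 (M i) (a i)) (Ψ i) 2 (R i τ) τ) atTop (𝓝 0)) ∧ (∀ τ₁ : ℝ, τ₀ ≤ τ₁ → O' \ (Φ '' (Minkowski.backgroundOn U₀).lateRegion τ₁ ∪ ⋃ i, Ψ i '' {x | τ₁ < (boostedKerrBackground (mo i).1 (mo i).2 (M i) (a i)).time x.1 ∧ (boostedKerrBackground (mo i).1 (mo i).2 (M i) (a i)).radius x.1 ≤ R i ((boostedKerrBackground (mo i).1 (mo i).2 (M i) (a i)).time x.1)}) ⊆ 𝒟.metric.causalPast 𝒟.timeOrientation (Φ '' (Minkowski.backgroundOn U₀).timeSlab τ₁ ∪ ⋃ i, Ψ i '' (boostedKerrBackground (mo i).1 (mo i).2 (M i) (a i)).truncTimeSlab (R i τ₁) τ₁)) ∧ (∀ i (r : ℝ), ∀ᶠ τ in atTop, ∀ x ∈ (boostedKerrBackground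 (mo i).1 (mo i).2 (M i) (a i)).truncTimeSlab r τ, 𝒟.toSpacetime.timeOrientation.IsFutureDirected (mfderiv 𝓘(ℝ, E4) (𝓡 4) (Ψ i) x (((mo i).1 : E4 ≃L[ℝ] E4) (Kerr.timeVector (M i) (a i) (poincareInv (mo i).1 (mo i).2 (x : E4)))))) ∧ ∀ᶠ τ in atTop, ∀ x ∈ (Minkowski.backgroundOn U₀).timeSlab τ, 𝒟.toSpacetime.timeOrientation.IsFutureDirected (mfderiv 𝓘(ℝ, E4) (𝓡 4) Φ x (E4.basisVector 0))

/-! ## Registered stubs (`sorry` only here; signatures def-free and self-contained; `stub_pinnedOfCauchyChain` (since v7,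
landed p157120) and `stub_settledExteriorHoldsRays` (since v9, derived from CENSOR-S and CENSOR-N) are no longer stubs but are
kept under their registered names) -/

/-- **FREEZE core, v10 — one FORWARD, FAT-CHAINED sharpening tracking chain with Cauchy labels (the renormalised-drift engine).**
For `0 < N`, `0 < m₀ ≤ 1`, `0 ≤ χ < 1`, every MGHD `𝒟` of an admissible datum with complete `𝓘⁺` tracked at EVERY accuracy with
complexity `(N, m₀, χ)` carries ONE chain `n ↦ cₙ` of `εₙ`-approximate `N`-Kerr configurations of one region `O`, in `C²`, on the
chart-time windows `[0, 1]` of their own charts, with: (a) `εₙ → 0`; (b) `Rₙ → ∞`; (c) exactly `N` holes; (d) masses in `[m₀, 1/m₀]`,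
spins `|aᵢ| ≤ χ Mᵢ`; (e) chained start slabs `slab₀(cₙ₊₁) ⊆ windowImage(cₙ)`; (f) window images leaving every compact past; (g)
`O = J⁺(ι X) ∩ I⁻(⋃ₙ windowImage(cₙ))`; (h) `O ⊆ J⁻(slab₀(c₀)) ∪ ⋃ₙ windowImage(cₙ)`; and, NEW IN v10, (k) FAT chaining:
`slab_σ(cₙ₊₁) ⊆ windowImage(cₙ)` for every `σ ∈ [0, 1/2]` (consecutive windows overlap on the slab `{σ ∈ [0, 1/2]}` of the later one, a set
of positive thickness — what seam rigidity (G1/G1K) consumes — instead of the start leaf only); (l) FORWARD HOLE CHARTS: at every point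
of the truncated window `{t*ᵢ ∈ [0, 1], rᵢ ≤ Rₙ}` the push-forward under `(cₙ).chart i` of the boosted background's future timelike field
`Λᵢ V_{Mᵢ,aᵢ}(Λᵢ⁻¹(x − cᵢ))` (`Kerr.timeVector`) is future-directed for `(g, τ_𝒟)` — the window form of `IsFutureOriented` (ii); (m)
FORWARD FLAT CHARTS: at every point of the flat window `{x⁰ ∈ [0, 1]} ∩ U₀` the push-forward of `∂₀` under `(cₙ).flatChart` is
future-directed — the window form of `IsFutureOriented` (iii); and (j) CAUCHY labels as in v9. Why the new clauses are free for the
engine and not for the gluing: the conclusion is existential and the construction (re-anchored GKS/DHRT bootstrap on slow steps) lays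
down its OWN windows — read in a future-directed gauge (the bootstrap's time function), on overlapping slow steps `[n/2, n/2 + 1]` —
whereas from the window structure alone hole-chart orientation is invisible (`ApproximateKerrConfiguration` fixes no time orientation and
Kerr's discrete isometry `β : (t, φ) ↦ (−t, −φ)` is NOT affine in ingoing Kerr–Schild coordinates, so UNORIENTED near-zone rigidity is
false: worker GLUE audit, `Missing.SeamRigidityKerr` needs both charts forward) and abutting windows overlap only in a leaf. Why plausibly
true / why it might fail / size / sources: exactly as for the v9 stub below (this is the same open engine K1 + K2 + K3 + first-law
budget; the added clauses are bookkeeping of the construction's output format). Size: open-problem. Sources: TeukolskyPress1974;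
doi:10.1063/1.1666203; arXiv:hep-th/9506161; KlainermanSzeftel2023; GiorgiKlainermanSzeftel2022; DafermosRodnianskiShlapentokhrothman2014;
ShlapentokhrothmanCosta2023; arXiv:2212.14093; Klainerman2025 §2.3; arXiv:0811.0354 §5.1 (`∇t*` timelike: the sign of chart time). -/
theorem stub_forwardSharpChain : ∀ (N : ℕ) (m₀ χ : ℝ), 0 < N → m₀ ≤ 1 → 0 < m₀ → 0 ≤ χ → χ < 1 → ∀ (X : Type) [TopologicalSpace X] [ChartedSpace E3 X] [IsManifold (𝓡 3) ((⊤ : ℕ∞) : WithTop ℕ∞) X] [T2Space X] [SecondCountableTopology X] [ConnectedSpace X], ∀ D ∈ admissibleVacuumData X, ∀ 𝒟 : VacuumCauchyDevelopment D, 𝒟.IsMaximal → Summit.FinalStateConjecture.HasCompleteNullInfinity 𝒟.toCauchyDevelopment → (∀ (L : ℝ) (ε : ENNReal) (R₀ : ℝ), 0 < L → 0 < ε → 𝒟.IsAdiabaticallyTracked N m₀ χ ε L R₀) → ∃ (ε : ℕ → ENNReal) (R : ℕ → ℝ) (O : Set 𝒟.carrier) (c : ∀ n : ℕ, ApproximateKerrConfiguration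 𝒟.toSpacetime O 2 (ε n) 0 1 (R n)), Tendsto ε atTop (𝓝 0) ∧ Tendsto R atTop atTop ∧ (∀ n, (c n).N = N) ∧ (∀ n (i : Fin (c n).N), m₀ ≤ (c n).mass i ∧ (c n).mass i ≤ m₀⁻¹ ∧ |(c n).spin i| ≤ χ * (c n).mass i) ∧ (∀ n, (c (n + 1)).certifiedSlab 0 ⊆ (c n).windowImage) ∧ (∀ K : Set 𝒟.carrier, IsCompact K → ∃ n₀ : ℕ, ∀ n, n₀ ≤ n → Disjoint (c n).windowImage (𝒟.metric.causalPast 𝒟.timeOrientation K)) ∧ O = 𝒟.toCauchyDevelopment.exteriorOf (⋃ n, (c n).windowImage) ∧ O ⊆ 𝒟.metric.causalPast 𝒟.timeOrientation ((c 0).certifiedSlab 0) ∪ ⋃ n, (c n).windowImage ∧ (∀ n, ∀ σ ∈ Set.Icc (0 : ℝ) (1 / 2), (c (n + 1)).certifiedSlab σ ⊆ (c n).windowImage) ∧ (∀ n (i : Fin (c n).N), ∀ x ∈ (boostedKerrBackground ((c n).motion i).1 ((c n).motion i).2 ((c n).mass i) ((c n).spin i)).truncWindow 0 1 (R n), 𝒟.toSpacetime.timeOrientation.IsFutureDirected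 (mfderiv 𝓘(ℝ, E4) (𝓡 4) ((c n).chart i) x ((((c n).motion i).1 : E4 ≃L[ℝ] E4) (Kerr.timeVector ((c n).mass i) ((c n).spin i) (poincareInv ((c n).motion i).1 ((c n).motion i).2 (x : E4)))))) ∧ (∀ n, ∀ x ∈ (Minkowski.backgroundOn (c n).flatDomain).window 0 1, 𝒟.toSpacetime.timeOrientation.IsFutureDirected (mfderiv 𝓘(ℝ, E4) (𝓡 4) (c n).flatChart x (E4.basisVector 0))) ∧ ∀ δ : ℝ, 0 < δ → ∃ n₀ : ℕ, ∀ n n' : ℕ, n₀ ≤ n → n₀ ≤ n' → ∀ (i : Fin (c n).N) (i' : Fin (c n').N), (i : ℕ) = (i' : ℕ) → |(c n).mass i - (c n').mass i'| ≤ δ ∧ |(c n).spin i - (c n').spin i'| ≤ δ ∧ ‖((((c n).motion i).1 : E4 ≃L[ℝ] E4) : E4 →L[ℝ] E4) - ((((c n').motion i').1 : E4 ≃L[ℝ] E4) : E4 →L[ℝ] E4)‖ ≤ δ := by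
  sorry

/-- **FREEZE core, v9 form (DERIVED since v10 from `stub_forwardSharpChain`: forget (k), (l), (m)) — one sharpening tracking chain with Cauchy labels (the renormalised-drift engine).** For `0 < N`,
`0 < m₀ ≤ 1`, `0 ≤ χ < 1`, every MGHD `𝒟` of an admissible datum with complete `𝓘⁺` tracked at EVERY accuracy with complexity
`(N, m₀, χ)` carries ONE chain `n ↦ cₙ` of `εₙ`-approximate `N`-Kerr configurations of the common region `O`, in `C²`, on the
chart-time windows `[0, 1]` of their own charts, with accuracies `εₙ → 0`, near-zone radii `Rₙ → ∞`, exactly `N` holes of masses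
in `[m₀, 1/m₀]` and spins `|aᵢ| ≤ χ Mᵢ`, chained start slabs (`slab₀(cₙ₊₁) ⊆ windowImage(cₙ)`), window images leaving every
compact past, `O = J⁺(ι X) ∩ I⁻(⋃ₙ window images)`, `O ⊆ J⁻(slab₀(c₀)) ∪ ⋃ₙ window images`, and CAUCHY labels: for every `δ > 0`
there is `n₀` such that any two windows `n, n' ≥ n₀` have `|Mᵢ⁽ⁿ⁾ − Mᵢ⁽ⁿ'⁾| ≤ δ`, `|aᵢ⁽ⁿ⁾ − aᵢ⁽ⁿ'⁾| ≤ δ`, `‖Λᵢ⁽ⁿ⁾ − Λᵢ⁽ⁿ'⁾‖ ≤ δ` for equal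
hole indices. Why plausibly true: this is the OUTPUT FORMAT of the route's mechanism — the renormalised (parameter-re-anchored)
GKS/DHRT bootstrap run on slow steps (card K2): each slow step is a window read in the re-anchored gauge at the accuracy the
decaying radiation dictates (`εₙ → 0` by K1, drift-uniform boundedness + integrated decay; zero-frequency solvability = linear
no-hair, K3, closes each step), and the re-anchoring increments are summable by the first law `dM = (κ/8π) dA + Ω_H dJ` fed by
Teukolsky–Press absorption (`dM − Ω_H dJ ≥ 0` off the superradiant band; bounded monotone area; radiated Bondi 4-momentum
bounded by radiated energy; time-integrable tidal exchange between receding holes, `O(M²/D²)`, `D ≳ t^{2/3}`): `Σₙ |δλₙ| < ∞`,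
i.e. Cauchy labels. Hole indexing, hole-chart time orientation and the asymptotic flat frame along the chain are the prover's
choice (the conclusion is existential). This is where the crux's named danger lives (parameters wandering adiabatically forever;
drift-uniform ILED through the moving threshold `mΩ_H(t)`). Size: open-problem (the engine: K1 + K2 + K3 + first-law budget).
Sources: TeukolskyPress1974; doi:10.1063/1.1666203 (Wald 1973); arXiv:hep-th/9506161 (CGO RG); KlainermanSzeftel2023;
GiorgiKlainermanSzeftel2022; DafermosRodnianskiShlapentokhrothman2014; ShlapentokhrothmanCosta2023; arXiv:2212.14093;
Klainerman2025 §2.3. -/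
theorem stub_sharpTrackingChain : ∀ (N : ℕ) (m₀ χ : ℝ), 0 < N → m₀ ≤ 1 → 0 < m₀ → 0 ≤ χ → χ < 1 → ∀ (X : Type) [TopologicalSpace X] [ChartedSpace E3 X] [IsManifold (𝓡 3) ((⊤ : ℕ∞) : WithTop ℕ∞) X] [T2Space X] [SecondCountableTopology X] [ConnectedSpace X], ∀ D ∈ admissibleVacuumData X, ∀ 𝒟 : VacuumCauchyDevelopment D, 𝒟.IsMaximal → Summit.FinalStateConjecture.HasCompleteNullInfinity 𝒟.toCauchyDevelopment → (∀ (L : ℝ) (ε : ENNReal) (R₀ : ℝ), 0 < L → 0 < ε → 𝒟.IsAdiabaticallyTracked N m₀ χ ε L R₀) → ∃ (ε : ℕ → ENNReal) (R : ℕ → ℝ) (O : Set 𝒟.carrier) (c : ∀ n : ℕ, ApproximateKerrConfiguration 𝒟.toSpacetime O 2 (ε n) 0 1 (R n)), Tendsto ε atTop (𝓝 0) ∧ Tendsto R atTop atTop ∧ (∀ n, (c n).N = N) ∧ (∀ n (i : Fin (c n).N), m₀ ≤ (c n).mass i ∧ (c n).mass i ≤ m₀⁻¹ ∧ |(c n).spin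 i| ≤ χ * (c n).mass i) ∧ (∀ n, (c (n + 1)).certifiedSlab 0 ⊆ (c n).windowImage) ∧ (∀ K : Set 𝒟.carrier, IsCompact K → ∃ n₀ : ℕ, ∀ n, n₀ ≤ n → Disjoint (c n).windowImage (𝒟.metric.causalPast 𝒟.timeOrientation K)) ∧ O = 𝒟.toCauchyDevelopment.exteriorOf (⋃ n, (c n).windowImage) ∧ O ⊆ 𝒟.metric.causalPast 𝒟.timeOrientation ((c 0).certifiedSlab 0) ∪ ⋃ n, (c n).windowImage ∧ ∀ δ : ℝ, 0 < δ → ∃ n₀ : ℕ, ∀ n n' : ℕ, n₀ ≤ n → n₀ ≤ n' → ∀ (i : Fin (c n).N) (i' : Fin (c n').N), (i : ℕ) = (i' : ℕ) → |(c n).mass i - (c n').mass i'| ≤ δ ∧ |(c n).spin i - (c n').spin i'| ≤ δ ∧ ‖((((c n).motion i).1 : E4 ≃L[ℝ] E4) : E4 →L[ℝ] E4) - ((((c n').motion i').1 : E4 ≃L[ℝ] E4) : E4 →L[ℝ] E4)‖ ≤ δ := by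
  intro N m₀ χ hN hm₁ hm₀ hχ₀ hχ₁ X _ _ _ _ _ _ D hD 𝒟 hmax hscri htrack
  obtain ⟨ε, R, O, c, hε, hRt, hcN, hM, hch, hex, hO, hcov, -, -, -, hcauchy⟩ :=
    stub_forwardSharpChain N m₀ χ hN hm₁ hm₀ hχ₀ hχ₁ X D hD 𝒟 hmax hscri htrack
  exact ⟨ε, R, O, c, hε, hRt, hcN, hM, hch, hex, hO, hcov, hcauchy⟩

/-- **FREEZE bookkeeping (sharpening-chain seam) — Cauchy labels converge to a point of the moduli space.** For any vacuum
Cauchy development `𝒟`, hole number `N` and bounds `m₀`, `χ`: a chain of `εₙ`-approximate `N`-Kerr configurations on windows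
`[0, 1]` with `εₙ → 0`, `Rₙ → ∞`, labels in the box, chaining, exhaustion, pinned and covered region, and CAUCHY labels, yields
ONE point `(M, a, Λ)` — `Mⱼ ∈ [m₀, 1/m₀]`, `|aⱼ| ≤ χ Mⱼ`, `Λⱼ ∈ O(1,3)` — and such a chain (the same one) eventually `δ`-pinned at
`(M, a, Λ)` for every `δ > 0`. FORMAL: the label vectors are a Cauchy sequence in the complete space
`(Fin N → ℝ) × (Fin N → ℝ) × (Fin N → (E4 →L[ℝ] E4))`, hence converge; they eventually lie in the closed label set (box × `η`-isometries
of norm `≤ ‖p‖ + 1`), so the limit is in the box and its boost components are Lorentz transformations. Size S (lead proves and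
lands it `--supports`; then derived in-file by name). [folklore] -/
theorem stub_pinnedOfCauchyChain : ∀ {X : Type} [TopologicalSpace X] [ChartedSpace E3 X] [IsManifold (𝓡 3) ((⊤ : ℕ∞) : WithTop ℕ∞) X] [ConnectedSpace X] {D : InitialDataSet (𝓡 3) X} (𝒟 : VacuumCauchyDevelopment D) (N : ℕ) (m₀ χ : ℝ), (∃ (ε : ℕ → ENNReal) (R : ℕ → ℝ) (O : Set 𝒟.carrier) (c : ∀ n : ℕ, ApproximateKerrConfiguration 𝒟.toSpacetime O 2 (ε n) 0 1 (R n)), Tendsto ε atTop (𝓝 0) ∧ Tendsto R atTop atTop ∧ (∀ n, (c n).N = N) ∧ (∀ n (i : Fin (c n).N), m₀ ≤ (c n).mass i ∧ (c n).mass i ≤ m₀⁻¹ ∧ |(c n).spin i| ≤ χ * (c n).mass i) ∧ (∀ n, (c (n + 1)).certifiedSlab 0 ⊆ (c n).windowImage) ∧ (∀ K : Set 𝒟.carrier, IsCompact K → ∃ n₀ : ℕ, ∀ n, n₀ ≤ n → Disjoint (c n).windowImage (𝒟.metric.causalPast 𝒟.timeOrientation K)) ∧ O = 𝒟.toCauchyDevelopment.exteriorOf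 (⋃ n, (c n).windowImage) ∧ O ⊆ 𝒟.metric.causalPast 𝒟.timeOrientation ((c 0).certifiedSlab 0) ∪ ⋃ n, (c n).windowImage ∧ ∀ δ : ℝ, 0 < δ → ∃ n₀ : ℕ, ∀ n n' : ℕ, n₀ ≤ n → n₀ ≤ n' → ∀ (i : Fin (c n).N) (i' : Fin (c n').N), (i : ℕ) = (i' : ℕ) → |(c n).mass i - (c n').mass i'| ≤ δ ∧ |(c n).spin i - (c n').spin i'| ≤ δ ∧ ‖((((c n).motion i).1 : E4 ≃L[ℝ] E4) : E4 →L[ℝ] E4) - ((((c n').motion i').1 : E4 ≃L[ℝ] E4) : E4 →L[ℝ] E4)‖ ≤ δ) → ∃ (M a : Fin N → ℝ) (Λ : Fin N → lorentzGroup), (∀ j, m₀ ≤ M j ∧ M j ≤ m₀⁻¹ ∧ |a j| ≤ χ * M j) ∧ ∃ (ε : ℕ → ENNReal) (R : ℕ → ℝ) (O : Set 𝒟.carrier) (c : ∀ n : ℕ, ApproximateKerrConfiguration 𝒟.toSpacetime O 2 (ε n) 0 1 (R n)), Tendsto ε atTop (𝓝 0) ∧ Tendsto R atTop atTop ∧ (∀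 n, (c n).N = N) ∧ (∀ n (i : Fin (c n).N), m₀ ≤ (c n).mass i ∧ (c n).mass i ≤ m₀⁻¹ ∧ |(c n).spin i| ≤ χ * (c n).mass i) ∧ (∀ n, (c (n + 1)).certifiedSlab 0 ⊆ (c n).windowImage) ∧ (∀ K : Set 𝒟.carrier, IsCompact K → ∃ n₀ : ℕ, ∀ n, n₀ ≤ n → Disjoint (c n).windowImage (𝒟.metric.causalPast 𝒟.timeOrientation K)) ∧ O = 𝒟.toCauchyDevelopment.exteriorOf (⋃ n, (c n).windowImage) ∧ O ⊆ 𝒟.metric.causalPast 𝒟.timeOrientation ((c 0).certifiedSlab 0) ∪ ⋃ n, (c n).windowImage ∧ ∀ δ : ℝ, 0 < δ → ∃ n₀ : ℕ, ∀ n, n₀ ≤ n → ∀ (i : Fin (c n).N) (j : Fin N), (i : ℕ) = (j : ℕ) → |(c n).mass i - M j| ≤ δ ∧ |(c n).spin i - a j| ≤ δ ∧ ‖((((c n).motion i).1 : E4 ≃L[ℝ] E4) : E4 →L[ℝ] E4) - (((Λ j : E4 ≃L[ℝ] E4)) : E4 →L[ℝ] E4)‖ ≤ δ :=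
  -- LANDED (p157120): `Theorems/RenormalisedDriftDriftCapturePinnedOfCauchyChain.lean`, by name and verbatim signature
  @_root_.Summit.FinalStateConjecture.FinalStateConjecture.Theorems.RenormalisedDrift.DriftCapture.stub_pinnedOfCauchyChain

/-- **ASSEMBLE, flat part (`N = 0`), v10 — one anchored CONVERGENT flat late chart (no orientation clause) from all-accuracy flat
tracking.** For every `m₀ > 0`, `0 ≤ χ < 1`, every MGHD `𝒟` of an admissible datum with complete `𝓘⁺` which is adiabatically tracked with
NO hole at every accuracy carries ONE anchored flat late chart: a flat domain `U₁ ⊇ {x⁰ > τ₁}`, a late chart `Φ : U₁ → 𝒟` into its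
self-determined exterior `J⁺(ι X) ∩ I⁻(Φ{x⁰ > τ₁})` whose `C²` deviation from `η` on the entire slabs `{x⁰ = τ}` tends to `0`, and whose
uncharted part beyond every chart time `τ ≥ τ₁` lies causally below the slab `Φ{x⁰ = τ}` — FOUR clauses: the v3–v9 five-clause stub minus
`Φ_* ∂₀ eventually future-directed`, which is AUTOMATIC (landed `stub_flatLateChartOfTracking_of_unoriented`, p165980: non-imprisonment in
the globally hyperbolic development, via the sister crux's `RecurrentlyFlatDisperses.stub_chartFuture` / `stub_anchorCone` applied to the
chart restarted at a `C⁰`-anchor time). The conclusion is VERBATIM the hypothesis of `RecurrentlyFlatDisperses.decomp_of_convergentChart`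
(p128814): the `N = 0` ASSEMBLE target of DriftCapture and the convergent anchored chart of crux stmt-FinalStateConjecture-14665 are one object.
Content (worker FLAT audit, `work/missing/stub_flatLateChartOfTracking_missing.lean`): NOT chart patching — global rigidity of near-isometries
of `η` on entire slabs is FALSE (F. John's rotation-and-strain drift `ψ(t,y) = (t, R(ε log⟨y⟩) y)`; only local/BMO forms hold, Reshetnyak
1989 Thms 12.14–12.18), per-accuracy chains may live in different asymptotic frames (V-bent entire slabs are legal `ε`-windows even in the
MGHD of the trivial datum), so any proof BUILDS a global gauge: `Missing_recurrentAnchoredChartOfFlatTracking` (all-accuracy flat tracking ⇒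
ONE anchored chart whose `C²`-flatness RECURS; XL) + `Missing_convergentChartOfRecurrentChart` (= 14665's open half (B) "recurrence ⇒
convergence" at `k = 2`; XL/open). Size XL. Sources: ChristodoulouKlainerman1993 Thm 1.0.2; arXiv:2104.08222 §1; Bartnik 1984
(doi:10.1007/bf01209300, maximal slices anchored at `i⁰`); `Cruxes/RecurrentlyFlatDisperses/Lines/Sketch-dead.md` §3 (B). -/
theorem stub_flatChartOfTrackingUnoriented : ∀ (m₀ χ : ℝ), 0 < m₀ → 0 ≤ χ → χ < 1 → ∀ (X : Type) [TopologicalSpace X] [ChartedSpace E3 X] [IsManifold (𝓡 3) ((⊤ : ℕ∞) : WithTop ℕ∞) X] [T2Space X] [SecondCountableTopology X] [ConnectedSpace X], ∀ D ∈ admissibleVacuumData X, ∀ 𝒟 : VacuumCauchyDevelopment D, 𝒟.IsMaximal → Summit.FinalStateConjecture.HasCompleteNullInfinity 𝒟.toCauchyDevelopment → (∀ (L : ℝ) (ε : ENNReal) (R₀ : ℝ), 0 < L → 0 < ε → 𝒟.IsAdiabaticallyTracked 0 m₀ χ ε L R₀) → ∃ (τ₁ : ℝ) (U₁ : TopologicalSpace.Opens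 E4) (Φ : U₁ → 𝒟.carrier), {x : E4 | τ₁ < x 0} ⊆ (U₁ : Set E4) ∧ 𝒟.toSpacetime.IsLateChart (Minkowski.backgroundOn U₁) (Summit.FinalStateConjecture.exteriorOf 𝒟.toCauchyDevelopment (Φ '' (Minkowski.backgroundOn U₁).lateRegion τ₁)) τ₁ Φ ∧ Tendsto (fun τ ↦ 𝒟.toSpacetime.deviationCk (Minkowski.backgroundOn U₁) Φ 2 τ) atTop (𝓝 0) ∧ (∀ τ : ℝ, τ₁ ≤ τ → Summit.FinalStateConjecture.exteriorOf 𝒟.toCauchyDevelopment (Φ '' (Minkowski.backgroundOn U₁).lateRegion τ₁) \ Φ '' (Minkowski.backgroundOn U₁).lateRegion τ ⊆ 𝒟.metric.causalPast 𝒟.timeOrientation (Φ '' (Minkowski.backgroundOn U₁).timeSlab τ)) := by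
  sorry

/-- **ASSEMBLE, flat part (`N = 0`), v3–v9 five-clause form (DERIVED since v10 from `stub_flatChartOfTrackingUnoriented` by the landed `stub_flatLateChartOfTracking_of_unoriented`, p165980) — one anchored flat late chart from all-accuracy flat tracking.**
UNCHANGED registered stub of v3 (see the v3 docstring in `Lines/birth.lean` history / lead report c0 §2):
for every `m₀ > 0`, `0 ≤ χ < 1`, every MGHD `𝒟` of an admissible datum with complete `𝓘⁺` which is adiabatically
tracked with NO hole at every accuracy carries ONE anchored flat late chart: a flat domain `U₁ ⊇ {x⁰ > τ₁}`, a
late chart `Φ : U₁ → 𝒟` into its self-determined exterior `J⁺(ι X) ∩ I⁻(Φ{x⁰ > τ₁})` whose `C²` deviation from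
`η` on the slabs `{x⁰ = τ}` tends to `0`, whose uncharted part beyond every chart time `τ ≥ τ₁` lies causally below
the slab `Φ{x⁰ = τ}`, and whose `∂₀` is eventually future-directed — hypothesis (i) of the landed
`Theorems.RenormalisedDrift.DriftCapture.globalGauge_zero_of_flatLateChart` verbatim. Why plausibly true: chained
`ε`-flat windows of accuracies `εₖ ↓ 0` differ on overlaps by `C³`-near-Poincaré maps (the isometry system of `η`
is of finite type), so they patch into one chart with deviation `→ 0`; exhaustion + covering give the causal
clause, chaining fixes the sign of `∂₀`. Why it might fail: windows of different accuracies are different chains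
(no common anchor); time-reversed windows are not excluded by the configuration structure; large data (no
smallness). Size L/XL (no chart-gluing API in the tree). Sources: ChristodoulouKlainerman1993 Thm 1.0.2 (shape);
arXiv:2104.08222 §1; `Cruxes/RecurrentlyFlatDisperses/Lines/Sketch-dead.md` §3 (B). -/
theorem stub_flatLateChartOfTracking : ∀ (m₀ χ : ℝ), 0 < m₀ → 0 ≤ χ → χ < 1 → ∀ (X : Type) [TopologicalSpace X] [ChartedSpace E3 X] [IsManifold (𝓡 3) ((⊤ : ℕ∞) : WithTop ℕ∞) X] [T2Space X] [SecondCountableTopology X] [ConnectedSpace X], ∀ D ∈ admissibleVacuumData X, ∀ 𝒟 : VacuumCauchyDevelopment D, 𝒟.IsMaximal → Summit.FinalStateConjecture.HasCompleteNullInfinity 𝒟.toCauchyDevelopment → (∀ (L : ℝ) (ε : ENNReal) (R₀ : ℝ), 0 < L → 0 < ε → 𝒟.IsAdiabaticallyTracked 0 m₀ χ ε L R₀) → ∃ (τ₁ : ℝ) (U₁ : TopologicalSpace.Opens E4) (Φ : U₁ → 𝒟.carrier), {x : E4 | τ₁ < x 0} ⊆ (U₁ : Set E4) ∧ 𝒟.toSpacetime.IsLateChart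 (Minkowski.backgroundOn U₁) (Summit.FinalStateConjecture.exteriorOf 𝒟.toCauchyDevelopment (Φ '' (Minkowski.backgroundOn U₁).lateRegion τ₁)) τ₁ Φ ∧ Tendsto (fun τ ↦ 𝒟.toSpacetime.deviationCk (Minkowski.backgroundOn U₁) Φ 2 τ) atTop (𝓝 0) ∧ (∀ τ : ℝ, τ₁ ≤ τ → Summit.FinalStateConjecture.exteriorOf 𝒟.toCauchyDevelopment (Φ '' (Minkowski.backgroundOn U₁).lateRegion τ₁) \ Φ '' (Minkowski.backgroundOn U₁).lateRegion τ ⊆ 𝒟.metric.causalPast 𝒟.timeOrientation (Φ '' (Minkowski.backgroundOn U₁).timeSlab τ)) ∧ ∀ᶠ τ in atTop, ∀ x ∈ (Minkowski.backgroundOn U₁).timeSlab τ, 𝒟.toSpacetime.timeOrientation.IsFutureDirected (mfderiv 𝓘(ℝ, E4) (𝓡 4) Φ x (E4.basisVector 0)) :=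
  -- LANDED (p165980): orientation is automatic
  _root_.Summit.FinalStateConjecture.FinalStateConjecture.Theorems.RenormalisedDrift.DriftCapture.stub_flatLateChartOfTracking_of_unoriented
    stub_flatChartOfTrackingUnoriented

/-- **ASSEMBLE, multi-hole GLUING (`0 < N`, `m₀ ≤ 1`), v10 — late charts from ONE forward, fat-chained sharpening pinned chain.**
(v10: the hypothesis chain carries the three extra clauses (k) fat chaining on `σ ∈ [0, 1/2]`, (l) forward hole charts, (m) forward flat
charts of `stub_forwardSharpChain`; the conclusion is unchanged. Remaining debts, typed by the worker GLUE audit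
(`work/missing/stub_glueSharpChain_missing.lean`, with the kernel-checked v9 reduction): (G1) `Missing.SeamRigidityFlat` (M: two `ε`-flat charts
overlapping on a cell differ there, in `C³` up to a modulus of `ε`, from `x ↦ Λx + d`, `Λ ∈ O(1,3)` — closeness to ONE Poincaré map on a whole
entire slab is FALSE, frame drift `O(ε · distance)`), (G1K) `Missing.SeamRigidityKerr` (L: the same for two FORWARD hole charts on boosted
Kerr–Schild exteriors, conclusion class `O(3) ×` time translations), (G0+G3) `Missing.RecedingAssembly` (XL: patching + the DYNAMICS the seam
cannot transmit — straight `o(t)` tubes in one far-field frame). (G2-orientation) `Missing.HoleChartsEventuallyForward` is DISCHARGED by clause (l).)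
v9 text of this docstring follows. **ASSEMBLE, multi-hole GLUING (`0 < N`, `m₀ ≤ 1`) — late charts from ONE sharpening pinned chain.** For `0 < N`,
`0 < m₀ ≤ 1`, `0 ≤ χ < 1`, every MGHD `𝒟` of an admissible datum with complete `𝓘⁺`, every point `(M, a, Λ)` of the moduli box: if
`𝒟` carries ONE chain of `εₙ`-approximate `N`-Kerr configurations on windows `[0, 1]` (`εₙ → 0`, `Rₙ → ∞`, `N` holes in the box,
chained start slabs, exhaustion, `O = J⁺(ι X) ∩ I⁻(⋃ windows)` covered) whose labels are, for every `δ > 0`, from some window on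
within `δ` of `(M, a, Λ)`, then there are motions `(Λᵢ', cᵢ)`, a late time `τ₀`, hole charts `Ψᵢ` on the boosted Kerr exteriors
`(Mᵢ, aᵢ, Λᵢ', cᵢ)`, sublinear excision radii `ρᵢ`, a flat domain `U₀ ⊇ {x⁰ > τ₀} ∖ tubes` with flat chart `Φ`, and honest growing
near-zone radii `Rᵢ → ∞` (no floor: `decomposition_of_unflooredLateCharts`, p158178, raises them above `max(r₊, 0) + 1` for free),
such that, with `O' := J⁺(ι X) ∩ I⁻(Φ{x⁰ > τ₀} ∪ ⋃ᵢ Ψᵢ{t*ᵢ > τ₀})`: all `N + 1` maps are late charts into `O'`, the truncated hole tubes eventually separate for every radius, `Φ^* g → η` in `C²` on the flat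
slabs, `Ψᵢ^* g → g_{Mᵢ,aᵢ}` in `C²` on `{t*ᵢ = τ, rᵢ ≤ Rᵢ(τ)}`, the part of `O'` beyond every chart time `τ₁ ≥ τ₀` not certified lies
causally below the certified slab at `τ₁`, and the push-forwards of `Λᵢ' V_{Mᵢ,aᵢ}` on truncated Kerr–Schild slabs and of `∂₀` on
flat slabs are eventually future-directed — the hypothesis list of the landed `decomposition_of_unflooredLateCharts` (p158178 ∘ p156248: the radius floor and the
orthochronicity of the `Λᵢ'` are manufactured for free). This statement is the route's foreseen RecedingAssembly — DYNAMICS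
(asymptotically free motion of well-separated near-Kerr bodies in vacuum: the straight sublinear tubes of ONE flat chart; the
far-field frame, near-isometries of `η` on entire slabs not being rigid at `i⁰`) — plus near-zone chart gluing; the window seam
cannot transmit kinematic budgets (no transition maps are recorded; on a unit window the boost label is gauge up to the tube
clause), so the momentum budget is re-derived here from the vacuum equations (wave-2 worker audit). Content (the ONE missing ingredient of
ASSEMBLE): window-chart GLUING along ONE chained sequence — (G1) near-isometry rigidity: consecutive windows `n`, `n + 1` overlap
(`slab₀(cₙ₊₁) ⊆ windowImage(cₙ)`), both are `εₙ`-close in `C²` to boosted Kerr with labels `δₙ`-close, so on the overlap their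
charts differ by a `C³`-near-isometry of the background (finite-type isometry system) — patch them; (G2) causal geometry of
window images: chart time vs causal order on entire slabs, the late part of the ONE region `O`, forward orientation from chaining
+ exhaustion (windows leave every compact past; entire flat slabs force net forward progress; the structure is blind to
`Λ ↦ Λ·T`, so hole charts may need the relabelling of p156248); (G3) the patching itself, drifts `Σ δₙ`-tails absorbed into the
chart maps and `o(t)` excision radii, `HasExhaustiveCharts` radii `Rᵢ(τ)` read off `Rₙ → ∞`. No tree API exists for any of this.
Size XL. Sources: arXiv:2104.08222 §1; KlainermanSzeftel2023 Thm 1.1; DafermosLuk2017 Conjecture 1 (b)–(c); arXiv:0811.0354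
§5.1; ONeill1983 Ch. 9. -/
theorem stub_glueForwardChain : ∀ (N : ℕ) (m₀ χ : ℝ), 0 < N → m₀ ≤ 1 → 0 < m₀ → 0 ≤ χ → χ < 1 → ∀ (X : Type) [TopologicalSpace X] [ChartedSpace E3 X] [IsManifold (𝓡 3) ((⊤ : ℕ∞) : WithTop ℕ∞) X] [T2Space X] [SecondCountableTopology X] [ConnectedSpace X], ∀ D ∈ admissibleVacuumData X, ∀ 𝒟 : VacuumCauchyDevelopment D, 𝒟.IsMaximal → Summit.FinalStateConjecture.HasCompleteNullInfinity 𝒟.toCauchyDevelopment → ∀ (M a : Fin N → ℝ) (Λ : Fin N → lorentzGroup), (∀ j, m₀ ≤ M j ∧ M j ≤ m₀⁻¹ ∧ |a j| ≤ χ * M j) → (∃ (ε : ℕ → ENNReal) (R : ℕ → ℝ) (O : Set 𝒟.carrier) (c : ∀ n : ℕ, ApproximateKerrConfiguration 𝒟.toSpacetime O 2 (ε n) 0 1 (R n)), Tendsto ε atTop (𝓝 0) ∧ Tendsto R atTop atTop ∧ (∀ n, (c n).N = N) ∧ (∀ n (i : Fin (c n).N), m₀ ≤ (c n).mass i ∧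 (c n).mass i ≤ m₀⁻¹ ∧ |(c n).spin i| ≤ χ * (c n).mass i) ∧ (∀ n, (c (n + 1)).certifiedSlab 0 ⊆ (c n).windowImage) ∧ (∀ K : Set 𝒟.carrier, IsCompact K → ∃ n₀ : ℕ, ∀ n, n₀ ≤ n → Disjoint (c n).windowImage (𝒟.metric.causalPast 𝒟.timeOrientation K)) ∧ O = 𝒟.toCauchyDevelopment.exteriorOf (⋃ n, (c n).windowImage) ∧ O ⊆ 𝒟.metric.causalPast 𝒟.timeOrientation ((c 0).certifiedSlab 0) ∪ ⋃ n, (c n).windowImage ∧ (∀ n, ∀ σ ∈ Set.Icc (0 : ℝ) (1 / 2), (c (n + 1)).certifiedSlab σ ⊆ (c n).windowImage) ∧ (∀ n (i : Fin (c n).N), ∀ x ∈ (boostedKerrBackground ((c n).motion i).1 ((c n).motion i).2 ((c n).mass i) ((c n).spin i)).truncWindow 0 1 (R n), 𝒟.toSpacetime.timeOrientation.IsFutureDirected (mfderiv 𝓘(ℝ, E4) (𝓡 4) ((c n).chart i) x ((((c n).motion i).1 : E4 ≃L[ℝ] E4) (Kerr.timeVector ((c n).mass i) ((c n).spin i) (poincareInv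 ((c n).motion i).1 ((c n).motion i).2 (x : E4)))))) ∧ (∀ n, ∀ x ∈ (Minkowski.backgroundOn (c n).flatDomain).window 0 1, 𝒟.toSpacetime.timeOrientation.IsFutureDirected (mfderiv 𝓘(ℝ, E4) (𝓡 4) (c n).flatChart x (E4.basisVector 0))) ∧ ∀ δ : ℝ, 0 < δ → ∃ n₀ : ℕ, ∀ n, n₀ ≤ n → ∀ (i : Fin (c n).N) (j : Fin N), (i : ℕ) = (j : ℕ) → |(c n).mass i - M j| ≤ δ ∧ |(c n).spin i - a j| ≤ δ ∧ ‖((((c n).motion i).1 : E4 ≃L[ℝ] E4) : E4 →L[ℝ] E4) - (((Λ j : E4 ≃L[ℝ] E4)) : E4 →L[ℝ] E4)‖ ≤ δ) → ∃ (O' : Set 𝒟.carrier) (mo : Fin N → lorentzGroup × E4) (τ₀ : ℝ) (Ψ : ∀ i, boostedKerrExterior (mo i).1 (mo i).2 (M i) (a i) → 𝒟.carrier) (ρ : Fin N → ℝ → ℝ) (U₀ : TopologicalSpace.Opens E4) (Φ : U₀ → 𝒟.carrier) (R : Fin N → ℝ → ℝ), O' = Summit.FinalStateConjecture.exteriorOf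 𝒟.toCauchyDevelopment (Φ '' (Minkowski.backgroundOn U₀).lateRegion τ₀ ∪ ⋃ i, Ψ i '' (boostedKerrBackground (mo i).1 (mo i).2 (M i) (a i)).lateRegion τ₀) ∧ (∀ i, 𝒟.toSpacetime.IsLateChart (boostedKerrBackground (mo i).1 (mo i).2 (M i) (a i)) O' τ₀ (Ψ i)) ∧ (∀ r : ℝ, ∃ τ₁ : ℝ, Pairwise (Function.onFun Disjoint fun i ↦ Ψ i '' (boostedKerrBackground (mo i).1 (mo i).2 (M i) (a i)).truncLateRegion τ₁ r)) ∧ (∀ i, Tendsto (fun t ↦ ρ i t / t) atTop (𝓝 0)) ∧ {x : E4 | τ₀ < x 0 ∧ ∀ i, ρ i (x 0) < Kerr.radius (a i) (poincareInv (mo i).1 (mo i).2 x)} ⊆ (U₀ : Set E4) ∧ 𝒟.toSpacetime.IsLateChart (Minkowski.backgroundOn U₀) O' τ₀ Φ ∧ Tendsto (fun τ ↦ 𝒟.toSpacetime.deviationCk (Minkowski.backgroundOn U₀) Φ 2 τ) atTop (𝓝 0) ∧ (∀ i, Tendsto (R i) atTop atTop) ∧ (∀ i, Tendsto (fun τ ↦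 𝒟.toSpacetime.truncDeviationCk (boostedKerrBackground (mo i).1 (mo i).2 (M i) (a i)) (Ψ i) 2 (R i τ) τ) atTop (𝓝 0)) ∧ (∀ τ₁ : ℝ, τ₀ ≤ τ₁ → O' \ (Φ '' (Minkowski.backgroundOn U₀).lateRegion τ₁ ∪ ⋃ i, Ψ i '' {x | τ₁ < (boostedKerrBackground (mo i).1 (mo i).2 (M i) (a i)).time x.1 ∧ (boostedKerrBackground (mo i).1 (mo i).2 (M i) (a i)).radius x.1 ≤ R i ((boostedKerrBackground (mo i).1 (mo i).2 (M i) (a i)).time x.1)}) ⊆ 𝒟.metric.causalPast 𝒟.timeOrientation (Φ '' (Minkowski.backgroundOn U₀).timeSlab τ₁ ∪ ⋃ i, Ψ i '' (boostedKerrBackground (mo i).1 (mo i).2 (M i) (a i)).truncTimeSlab (R i τ₁) τ₁)) ∧ (∀ i (r : ℝ), ∀ᶠ τ in atTop, ∀ x ∈ (boostedKerrBackground (mo i).1 (mo i).2 (M i) (a i)).truncTimeSlab r τ, 𝒟.toSpacetime.timeOrientation.IsFutureDirected (mfderiv 𝓘(ℝ, E4) (𝓡 4) (Ψ i) x (((mo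 i).1 : E4 ≃L[ℝ] E4) (Kerr.timeVector (M i) (a i) (poincareInv (mo i).1 (mo i).2 (x : E4)))))) ∧ ∀ᶠ τ in atTop, ∀ x ∈ (Minkowski.backgroundOn U₀).timeSlab τ, 𝒟.toSpacetime.timeOrientation.IsFutureDirected (mfderiv 𝓘(ℝ, E4) (𝓡 4) Φ x (E4.basisVector 0)) := by
  sorry

/-- The v9 registered gluing statement (`Sig.stub_glueSharpChain`: the same conclusion from a chain WITHOUT clauses (k), (l), (m))
implies the v10 one — so the worker's typed reduction `stub_glueSharpChain_of_missing` (v9) composes with v10. [folklore] -/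
theorem glueForwardChain_of_glueSharpChain (h : Sig.stub_glueSharpChain) : Sig.stub_glueForwardChain := by
  intro N m₀ χ hN hm₁ hm₀ hχ₀ hχ₁ X _ _ _ _ _ _ D hD 𝒟 hmax hscri M a Λ hbox hchain
  obtain ⟨ε, R, O, c, hε, hRt, hcN, hM, hch, hex, hO, hcov, -, -, -, hpin⟩ := hchain
  exact h N m₀ χ hN hm₁ hm₀ hχ₀ hχ₁ X D hD 𝒟 hmax hscri M a Λ hbox ⟨ε, R, O, c, hε, hRt, hcN, hM, hch, hex, hO, hcov, hpin⟩

/-- **CENSOR-S — the charts' past swallows the end-visible domain of outer communications** (chart side, size L; v9,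
VERBATIM the registered stub `stub_chartsShadowEndVisibleRegion` of crux stmt-FinalStateConjecture-17673, skeleton
`Cruxes/SettledExteriorHoldsRays/Lines/birth.lean`). For every admissible datum `D`, every MGHD `𝒟` with complete `𝓘⁺` and every
sub-extremal `fd : FinalStateDecomposition 𝒟.toSpacetime O 2` with `O = exteriorOf 𝒟 fd.charted`, `HasExhaustiveCharts fd`,
`IsFutureOriented fd`: `endVisibleRegion 𝒟 ∩ J⁺(ιX) ⊆ exteriorOf 𝒟 fd.charted` — every event to the causal future of the data lying in
the chronological past of a future-complete normalised null ray launched outside any prescribed compact piece of `Σ`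
(`EndVisible.IsEndVisibleEvent`) is in `I⁻(fd.charted)`. Why plausibly true: the flat chart of an honest `fd` is an open embedding of
the whole late half-space minus sublinear tubes with `Φ^*g → η` in unweighted `C²` on ENTIRE slabs and image in `J⁺(ιX)`; a complete
uniformly quasi-flat uniformly spacelike slab cannot tilt to null in a sector (isotropic tilt contradicts Euclidean volume growth —
the cone lemma of `Cruxes/PocketExists/STRATEGY-CENSUS.md`; one-directional tilt contradicts image ⊆ `J⁺(ιX)`), so every late point of
the end's `𝓘⁺` is in the radiation zone and every far-launched complete ray keeps returning to `J⁻(fd.charted)`; near-zone charts cover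
`{r > r₊}`; a far ray entering a hole beyond the collar does so near `i⁺` and is incomplete there (Dafermos–Luk `C⁰`-stable Cauchy
horizon). Why it might fail: a legal flat chart whose slab images go asymptotically null in a sector; a complete far-launched infalling
ray in a non-generic late interior. Leans on (landed): `EndVisible.FarRaysShadowedBy` + `endVisibleRegion_inter_causalFuture_subset_exteriorOf`
(FarRaysShadowedBy ⇒ S), `SubMinkowski.farRaysShadowedBy_charted_subDecomp` (flat class), `FinalStateDecomposition.diff_subset_causalPast`,
`IsLateChart.image_subset`. Sources: DafermosLuk2017 Conjecture 1 (arXiv:1710.01722); HawkingEllis1973 §9.2; ONeill1983 Ch. 14;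
arXiv:0811.0354 §2.6.2; Christodoulou1999 pp. A26–A27. -/
theorem stub_chartsShadowEndVisibleRegion : open Literature.Geometry.Lorentzian Summit.FinalStateConjecture.FinalStateConjecture.Theorems in open scoped Manifold ContDiff in ∀ (X : Type) [TopologicalSpace X] [ChartedSpace E3 X] [IsManifold (𝓡 3) ∞ X] [T2Space X] [SecondCountableTopology X] [ConnectedSpace X] (D : InitialDataSet (𝓡 3) X), D ∈ admissibleVacuumData X → ∀ 𝒟 : VacuumCauchyDevelopment D, 𝒟.IsMaximal → Summit.FinalStateConjecture.HasCompleteNullInfinity 𝒟.toCauchyDevelopment → ∀ (O : Set 𝒟.carrier) (fd : FinalStateDecomposition 𝒟.toSpacetime O 2), (∀ i, Kerr.IsSubextremal (fd.mass i) (fd.spin i)) → O = Summit.FinalStateConjecture.exteriorOf 𝒟.toCauchyDevelopment fd.charted → Summit.FinalStateConjecture.HasExhaustiveCharts fd → Summit.FinalStateConjecture.IsFutureOriented fd → ∀ [𝒟.metric.HasLeviCivita], EndVisible.endVisibleRegion 𝒟.toCauchyDevelopment ∩ 𝒟.metric.causalFuture 𝒟.timeOrientation (Set.range 𝒟.embed)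 ⊆ Summit.FinalStateConjecture.exteriorOf 𝒟.toCauchyDevelopment fd.charted := by
  sorry

/-- **CENSOR-N — no hidden complete rays** (interior / topology side, size XL, OPERATOR-CONTINGENT; v9, VERBATIM the registered
stub `stub_noHiddenCompleteRays` of crux stmt-FinalStateConjecture-17673). For every admissible datum `D`, every MGHD `𝒟` with
complete `𝓘⁺` and every sub-extremal honest exhaustive future-oriented `2`-decomposition `fd` (so: for every censored MGHD that also
settles honestly in the end): `EndVisible.CompleteRaysNearEndVisible 𝒟` — every point `γ t`, `t ≥ 0`, of every future-complete
normalised null ray from `Σ` lies in `closure (endVisibleRegion 𝒟)`; equivalently (landed iff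
`completeRaysNearEndVisible_iff_outerRegion_subset`) `outerRegion 𝒟 ⊆ endVisibleRegion 𝒟`. Chart-free. Why plausibly true on
`X ≅ ℝ³`: complete null geodesics inside sub-extremal black holes do not exist unless the far end sees them (exact Kerr:
`KerrBlackHoleNoCompleteNullRay_holds`, `Kerr.completeNullRay_mem_closure_exterior`; near `i⁺`: arXiv:1710.01722); TRUE on the flat
class (`ChannelsResolveTameDevelopmentsR/Negative/MinkowskiEndVisible.lean`); TRUE in the exact one-ended model ℝP³ geon (interior rays
end at `r = 0`, horizon generators are limits of escaping rays). Why it might fail (and why it is operator-contingent): a hidden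
future-complete region behind an event horizon — an expanding vacuum pocket (closed hyperbolic Löbell slice) behind the neck of
`X = ℝ³ # H³/Γ` whose AF exterior nevertheless settles (and is tracked at every accuracy): the global future of the punctured pocket
is open (H2 of `Cruxes/PocketExists/STRATEGY-CENSUS.md`), and whether clause (C) should see such rays at all is the pending summit
ruling Q-F1. For THIS crux: on pocketed tracked data no honest witness satisfies clause (C), so DriftCapture as typed is decided there
by exactly this stub (report `Lines/birth-lead-c3.md` §3). Sources: DafermosLuk2017 (Conjecture 1, p. 10: no interior claim);
HawkingEllis1973 §9.2; Wald1984 §12.1; Penrose1965; arXiv:1710.01722; arXiv:gr-qc/0303045; arXiv:2408.06715 p. 4. -/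
theorem stub_noHiddenCompleteRays : open Literature.Geometry.Lorentzian Summit.FinalStateConjecture.FinalStateConjecture.Theorems in open scoped Manifold ContDiff in ∀ (X : Type) [TopologicalSpace X] [ChartedSpace E3 X] [IsManifold (𝓡 3) ∞ X] [T2Space X] [SecondCountableTopology X] [ConnectedSpace X] (D : InitialDataSet (𝓡 3) X), D ∈ admissibleVacuumData X → ∀ 𝒟 : VacuumCauchyDevelopment D, 𝒟.IsMaximal → Summit.FinalStateConjecture.HasCompleteNullInfinity 𝒟.toCauchyDevelopment → ∀ (O : Set 𝒟.carrier) (fd : FinalStateDecomposition 𝒟.toSpacetime O 2), (∀ i, Kerr.IsSubextremal (fd.mass i) (fd.spin i)) → O = Summit.FinalStateConjecture.exteriorOf 𝒟.toCauchyDevelopment fd.charted → Summit.FinalStateConjecture.HasExhaustiveCharts fd → Summit.FinalStateConjecture.IsFutureOriented fd → EndVisible.CompleteRaysNearEndVisible 𝒟.toCauchyDevelopment := by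
  sorry

/-- **CENSOR (derived since v9) — a settled exterior holds its rays**, i.e. the shared item stmt-FinalStateConjecture-17673
`SettledExteriorHoldsRays` verbatim, from CENSOR-S and CENSOR-N exactly as in that crux's registered composition
`SettledExteriorHoldsRays_of`: N in set form puts the intrinsic domain of outer communications inside the end-visible region
(`EndVisible.outerRegion_subset_endVisibleRegion_of_completeRaysNearEndVisible`, push-up through the open `I⁺(q)`); S takes its part to
the causal future of the data into `exteriorOf 𝒟 fd.charted = O`; adherence of complete-ray points to the outer region plus push-up
(`EndVisible.raysStayInClosure_of_outerRegion_subset_closure`) convert `outerRegion ⊆ closure O` into `RaysStayInClosure 𝒟 O`.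
Kept under its registered v1–v8 name; no `sorry` of its own. [cite: DafermosLuk2017, Conjecture 1] -/
theorem stub_settledExteriorHoldsRays : open Literature.Geometry.Lorentzian in open scoped ContDiff in ∀ (X : Type) [TopologicalSpace X] [ChartedSpace E3 X] [IsManifold (𝓡 3) ∞ X] [T2Space X] [SecondCountableTopology X] [ConnectedSpace X] (D : InitialDataSet (𝓡 3) X), D ∈ admissibleVacuumData X → ∀ 𝒟 : VacuumCauchyDevelopment D, 𝒟.IsMaximal → Summit.FinalStateConjecture.HasCompleteNullInfinity 𝒟.toCauchyDevelopment → ∀ (O : Set 𝒟.carrier) (fd : FinalStateDecomposition 𝒟.toSpacetime O 2), (∀ i, Kerr.IsSubextremal (fd.mass i) (fd.spin i)) → O = Summit.FinalStateConjecture.exteriorOf 𝒟.toCauchyDevelopment fd.charted → Summit.FinalStateConjecture.HasExhaustiveCharts fd → Summit.FinalStateConjecture.IsFutureOriented fd → Summit.FinalStateConjecture.RaysStayInClosure 𝒟.toCauchyDevelopment O := by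
  intro X _ _ _ _ _ _ D hD 𝒟 hmax hscri O fd hsub hO hexh hfo
  -- N: no future-complete normalised null ray from `Σ` is hidden from the end (in `𝒟`)
  have hN' : Summit.FinalStateConjecture.FinalStateConjecture.Theorems.EndVisible.CompleteRaysNearEndVisible
      𝒟.toCauchyDevelopment :=
    stub_noHiddenCompleteRays X D hD 𝒟 hmax hscri O fd hsub hO hexh hfo
  -- adherence + push-up (landed): it suffices that the outer region lies in `closure O`
  apply Summit.FinalStateConjecture.FinalStateConjecture.Theorems.EndVisible.raysStayInClosure_of_outerRegion_subset_closure
  intro hLC q hq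
  -- N in set form makes `q` end-visible; S puts end-visible events to the future of the data into `exteriorOf 𝒟 fd.charted = O`
  have hq' : q ∈ Summit.FinalStateConjecture.exteriorOf 𝒟.toCauchyDevelopment fd.charted :=
    stub_chartsShadowEndVisibleRegion X D hD 𝒟 hmax hscri O fd hsub hO hexh hfo
      ⟨Summit.FinalStateConjecture.FinalStateConjecture.Theorems.EndVisible.outerRegion_subset_endVisibleRegion_of_completeRaysNearEndVisible
          hN' hq, hq.1⟩
  rw [hO]
  exact subset_closure hq'

/-! Consistency (elaborated, not kept): each expanded stub statement is the legend proposition the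
composition consumes. -/
example : Sig.stub_sharpTrackingChain := stub_sharpTrackingChain
example : Sig.stub_pinnedOfCauchyChain := stub_pinnedOfCauchyChain
example : Sig.stub_flatLateChartOfTracking := stub_flatLateChartOfTracking
example : Sig.stub_forwardSharpChain := stub_forwardSharpChain
example : Sig.stub_flatChartOfTrackingUnoriented := stub_flatChartOfTrackingUnoriented
example : Sig.stub_glueForwardChain := stub_glueForwardChain
example : Sig.stub_chartsShadowEndVisibleRegion := stub_chartsShadowEndVisibleRegion
example : Sig.stub_noHiddenCompleteRays := stub_noHiddenCompleteRays
example : Sig.stub_settledExteriorHoldsRays := stub_settledExteriorHoldsRays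

/-! ## The composition (kernel-checked; no `sorry` of its own) -/

/-- **FREEZE (derived): one point of the moduli space and one sharpening chain eventually pinned at it**, on the live
range, from `stub_sharpTrackingChain` (the engine) and `stub_pinnedOfCauchyChain` (completeness). -/
theorem pinnedSharpChain_of_stubs (h₁ : Sig.stub_sharpTrackingChain) (h₂ : Sig.stub_pinnedOfCauchyChain) :
    ∀ (N : ℕ) (m₀ χ : ℝ), 0 < N → m₀ ≤ 1 → 0 < m₀ → 0 ≤ χ → χ < 1 → ∀ (X : Type) [TopologicalSpace X] [ChartedSpace E3 X] [IsManifold (𝓡 3) ((⊤ : ℕ∞) : WithTop ℕ∞) X] [T2Space X] [SecondCountableTopology X] [ConnectedSpace X],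
      ∀ D ∈ admissibleVacuumData X, ∀ 𝒟 : VacuumCauchyDevelopment D, 𝒟.IsMaximal →
      Summit.FinalStateConjecture.HasCompleteNullInfinity 𝒟.toCauchyDevelopment →
      (∀ (L : ℝ) (ε : ENNReal) (R₀ : ℝ), 0 < L → 0 < ε → 𝒟.IsAdiabaticallyTracked N m₀ χ ε L R₀) →
      ∃ (M a : Fin N → ℝ) (Λ : Fin N → lorentzGroup), (∀ j, m₀ ≤ M j ∧ M j ≤ m₀⁻¹ ∧ |a j| ≤ χ * M j) ∧ ∃ (ε : ℕ → ENNReal) (R : ℕ → ℝ) (O : Set 𝒟.carrier) (c : ∀ n : ℕ, ApproximateKerrConfiguration 𝒟.toSpacetime O 2 (ε n) 0 1 (R n)), Tendsto ε atTop (𝓝 0) ∧ Tendsto R atTop atTop ∧ (∀ n, (c n).N = N) ∧ (∀ n (i : Fin (c n).N), m₀ ≤ (c n).mass i ∧ (c n).mass i ≤ m₀⁻¹ ∧ |(c n).spin i| ≤ χ * (c n).mass i) ∧ (∀ n, (c (n + 1)).certifiedSlab 0 ⊆ (c n).windowImage) ∧ (∀ K : Set 𝒟.carrier, IsCompact K →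 ∃ n₀ : ℕ, ∀ n, n₀ ≤ n → Disjoint (c n).windowImage (𝒟.metric.causalPast 𝒟.timeOrientation K)) ∧ O = 𝒟.toCauchyDevelopment.exteriorOf (⋃ n, (c n).windowImage) ∧ O ⊆ 𝒟.metric.causalPast 𝒟.timeOrientation ((c 0).certifiedSlab 0) ∪ ⋃ n, (c n).windowImage ∧ ∀ δ : ℝ, 0 < δ → ∃ n₀ : ℕ, ∀ n, n₀ ≤ n → ∀ (i : Fin (c n).N) (j : Fin N), (i : ℕ) = (j : ℕ) → |(c n).mass i - M j| ≤ δ ∧ |(c n).spin i - a j| ≤ δ ∧ ‖((((c n).motion i).1 : E4 ≃L[ℝ] E4) : E4 →L[ℝ] E4) - (((Λ j : E4 ≃L[ℝ] E4)) : E4 →L[ℝ] E4)‖ ≤ δ := by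
  intro N m₀ χ hN hm₁ hm₀ hχ₀ hχ₁ X _ _ _ _ _ _ D hD 𝒟 hmax hscri htrack
  exact h₂ 𝒟 N m₀ χ (h₁ N m₀ χ hN hm₁ hm₀ hχ₀ hχ₁ X D hD 𝒟 hmax hscri htrack)

/-- **ASSEMBLE on the live multi-hole range (derived)**: sharp chain → pin → glue → package (the landed
`decomposition_of_unflooredLateCharts`, p158178, raises the radii above the floor, relabels the motions orthochronous via p156248 and
packages via p151942). The
`C²` decomposition has `d.N = N`, labels `(M, a)` from the moduli box, `O' = exteriorOf 𝒟 d.charted`, honest exhaustive charts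
and future orientation. -/
theorem globalGaugePos_of_stubs (h₁ : Sig.stub_sharpTrackingChain) (h₂ : Sig.stub_pinnedOfCauchyChain)
    (h₃ : Sig.stub_glueSharpChain) :
    ∀ (N : ℕ) (m₀ χ : ℝ), 0 < N → m₀ ≤ 1 → 0 < m₀ → 0 ≤ χ → χ < 1 → ∀ (X : Type) [TopologicalSpace X] [ChartedSpace E3 X] [IsManifold (𝓡 3) ((⊤ : ℕ∞) : WithTop ℕ∞) X] [T2Space X] [SecondCountableTopology X] [ConnectedSpace X],
      ∀ D ∈ admissibleVacuumData X, ∀ 𝒟 : VacuumCauchyDevelopment D, 𝒟.IsMaximal →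
      Summit.FinalStateConjecture.HasCompleteNullInfinity 𝒟.toCauchyDevelopment →
      (∀ (L : ℝ) (ε : ENNReal) (R₀ : ℝ), 0 < L → 0 < ε → 𝒟.IsAdiabaticallyTracked N m₀ χ ε L R₀) →
      ∃ (M a : Fin N → ℝ) (O' : Set 𝒟.carrier) (d : FinalStateDecomposition 𝒟.toSpacetime O' 2),
        (∀ j, m₀ ≤ M j ∧ M j ≤ m₀⁻¹ ∧ |a j| ≤ χ * M j) ∧ d.N = N ∧
        (∀ (i : Fin d.N) (j : Fin N), (i : ℕ) = (j : ℕ) → d.mass i = M j ∧ d.spin i = a j) ∧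
        O' = Summit.FinalStateConjecture.exteriorOf 𝒟.toCauchyDevelopment d.charted ∧
        Summit.FinalStateConjecture.HasExhaustiveCharts d ∧ Summit.FinalStateConjecture.IsFutureOriented d := by
  intro N m₀ χ hN hm₁ hm₀ hχ₀ hχ₁ X _ _ _ _ _ _ D hD 𝒟 hmax hscri htrack
  obtain ⟨M, a, Λ, hbox, hpin⟩ :=
    pinnedSharpChain_of_stubs h₁ h₂ N m₀ χ hN hm₁ hm₀ hχ₀ hχ₁ X D hD 𝒟 hmax hscri htrack
  have hMpos : ∀ j, 0 < M j := fun j ↦ hm₀.trans_le (hbox j).1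
  have ha : ∀ j, |a j| ≤ M j := fun j ↦
    (hbox j).2.2.trans (mul_le_of_le_one_left (hMpos j).le hχ₁.le)
  obtain ⟨O', mo, τ₀, Ψ, ρ, U₀, Φ, R, hO', hlate, hsep, hexc, hdom, hflat, hdev, hR, htrunc, hcov, hfutK, hfutF⟩ :=
    h₃ N m₀ χ hN hm₁ hm₀ hχ₀ hχ₁ X D hD 𝒟 hmax hscri M a Λ hbox hpin
  obtain ⟨d, hdN, hlab, hO'', hexh, hfut⟩ :=
    _root_.Summit.FinalStateConjecture.FinalStateConjecture.Theorems.RenormalisedDrift.DriftCapture.decomposition_of_unflooredLateCharts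
      𝒟.toCauchyDevelopment N M a hMpos ha O' mo τ₀ Ψ ρ U₀ Φ R hO' hlate hsep hexc hdom hflat hdev hR htrunc hcov hfutK hfutF
  exact ⟨M, a, O', d, hbox, hdN, hlab, hO'', hexh, hfut⟩

/-- **THE CRUX BY NAME from the five stubs.** Case split on the complexity: `N = 0` — the anchored flat late chart of
`stub_flatLateChartOfTracking` packaged by the landed `globalGauge_zero_of_flatLateChart` (p148929), no hole to be
sub-extremal; `0 < N`, `1 < m₀` — the all-accuracy tracking hypothesis is unsatisfiable (landed
`not_isAdiabaticallyTracked_of_one_lt`, p150050); `0 < N`, `m₀ ≤ 1` — `globalGaugePos_of_stubs`, every hole of `d` strictly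
sub-extremal because `|aⱼ| ≤ χ Mⱼ < Mⱼ` (`χ < 1`, `0 < m₀ ≤ Mⱼ`). In all cases CENSOR (the shared item, by name) supplies
`RaysStayInClosure`. -/
theorem DriftCapture_of :
    Sig.stub_sharpTrackingChain → Sig.stub_pinnedOfCauchyChain → Sig.stub_flatLateChartOfTracking →
      Sig.stub_glueSharpChain → Sig.stub_settledExteriorHoldsRays →
      Summit.FinalStateConjecture.FinalStateConjecture.Theses.RenormalisedDrift.DriftCapture := by
  intro h₁ h₂ h₀ h₃ h₄ N m₀ χ hm₀ hχ₀ hχ₁ X _ _ _ _ _ _ D hD 𝒟 hmax hscri htrack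
  rcases Nat.eq_zero_or_pos N with rfl | hN
  · -- dispersal: flat late chart, packaged
    obtain ⟨O', d, hdN, -, hO', hexh, hfut⟩ :=
      _root_.Summit.FinalStateConjecture.FinalStateConjecture.Theorems.RenormalisedDrift.DriftCapture.globalGauge_zero_of_flatLateChart
        h₀ m₀ χ hm₀ hχ₀ hχ₁ X D hD 𝒟 hmax hscri Fin.elim0 Fin.elim0 Fin.elim0 (fun j ↦ j.elim0)
        (fun δ _ L ε R₀ hL hε ↦ by
          obtain ⟨R, O, c, hR, hRt, hcN, hM, hch, hex, hO, hcov⟩ := htrack L ε R₀ hL hε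
          exact ⟨R, O, c, hR, hRt, hcN, hM, fun n i j _ ↦ j.elim0, hch, hex, hO, hcov⟩)
    have hsub : ∀ i, Kerr.IsSubextremal (d.mass i) (d.spin i) := fun i ↦
      (Fin.cast hdN i).elim0
    exact ⟨O', d, hsub, hO', h₄ X D hD 𝒟 hmax hscri O' d hsub hO' hexh hfut, hexh, hfut⟩
  · rcases le_or_gt m₀ 1 with hm₁ | hlt
    · -- live multi-hole range
      obtain ⟨M, a, O', d, hbox, hdN, hlab, hO', hexh, hfut⟩ :=
        globalGaugePos_of_stubs h₁ h₂ h₃ N m₀ χ hN hm₁ hm₀ hχ₀ hχ₁ X D hD 𝒟 hmax hscri htrack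
      have hsub : ∀ i, Kerr.IsSubextremal (d.mass i) (d.spin i) := fun i ↦ by
        have hi : (i : ℕ) < N := i.isLt.trans_eq hdN
        obtain ⟨hM, ha⟩ := hlab i ⟨i, hi⟩ rfl
        obtain ⟨h1, -, h3⟩ := hbox ⟨i, hi⟩
        have hMpos : 0 < M ⟨i, hi⟩ := hm₀.trans_le h1
        show |d.spin i| < d.mass i
        rw [hM, ha]
        calc |a ⟨i, hi⟩| ≤ χ * M ⟨i, hi⟩ := h3
          _ < 1 * M ⟨i, hi⟩ := mul_lt_mul_of_pos_right hχ₁ hMpos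
          _ = M ⟨i, hi⟩ := one_mul _
      exact ⟨O', d, hsub, hO', h₄ X D hD 𝒟 hmax hscri O' d hsub hO' hexh hfut, hexh, hfut⟩
    · -- degenerate range: the seam is unsatisfiable
      exact absurd (htrack 1 1 0 one_pos one_pos)
        (_root_.Summit.FinalStateConjecture.FinalStateConjecture.Theorems.RenormalisedDrift.DriftCapture.not_isAdiabaticallyTracked_of_one_lt
          𝒟 hN hlt)

/-- **CENSOR from CENSOR-S and CENSOR-N at the legend level** (v9): the monolithic v1–v8 CENSOR proposition (= item
stmt-FinalStateConjecture-17673 verbatim) from the two end-visibility halves, by the same ten lines as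
`stub_settledExteriorHoldsRays` (landed `EndVisible` set API). [cite: DafermosLuk2017, Conjecture 1] -/
theorem censor_of_SN (hS : Sig.stub_chartsShadowEndVisibleRegion) (hN : Sig.stub_noHiddenCompleteRays) :
    Sig.stub_settledExteriorHoldsRays := by
  intro X _ _ _ _ _ _ D hD 𝒟 hmax hscri O fd hsub hO hexh hfo
  have hN' : Summit.FinalStateConjecture.FinalStateConjecture.Theorems.EndVisible.CompleteRaysNearEndVisible
      𝒟.toCauchyDevelopment :=
    hN X D hD 𝒟 hmax hscri O fd hsub hO hexh hfo
  apply Summit.FinalStateConjecture.FinalStateConjecture.Theorems.EndVisible.raysStayInClosure_of_outerRegion_subset_closure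
  intro hLC q hq
  have hq' : q ∈ Summit.FinalStateConjecture.exteriorOf 𝒟.toCauchyDevelopment fd.charted :=
    hS X D hD 𝒟 hmax hscri O fd hsub hO hexh hfo
      ⟨Summit.FinalStateConjecture.FinalStateConjecture.Theorems.EndVisible.outerRegion_subset_endVisibleRegion_of_completeRaysNearEndVisible
          hN' hq, hq.1⟩
  rw [hO]
  exact subset_closure hq'

/-- **FREEZE, v10 (derived): one point of the moduli space and the SAME forward fat-chained sharpening chain eventually pinned at it**,
on the live range, from `stub_forwardSharpChain` (the engine) and the landed same-family pin `exists_pinned_of_cauchyLabels` (p167385). -/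
theorem pinnedForwardChain_of_stubs (h₁ : Sig.stub_forwardSharpChain) :
    ∀ (N : ℕ) (m₀ χ : ℝ), 0 < N → m₀ ≤ 1 → 0 < m₀ → 0 ≤ χ → χ < 1 → ∀ (X : Type) [TopologicalSpace X] [ChartedSpace E3 X] [IsManifold (𝓡 3) ((⊤ : ℕ∞) : WithTop ℕ∞) X] [T2Space X] [SecondCountableTopology X] [ConnectedSpace X], ∀ D ∈ admissibleVacuumData X, ∀ 𝒟 : VacuumCauchyDevelopment D, 𝒟.IsMaximal → Summit.FinalStateConjecture.HasCompleteNullInfinity 𝒟.toCauchyDevelopment → (∀ (L : ℝ) (ε : ENNReal) (R₀ : ℝ), 0 < L → 0 < ε → 𝒟.IsAdiabaticallyTracked N m₀ χ ε L R₀) → ∃ (M a : Fin N → ℝ) (Λ : Fin N → lorentzGroup), (∀ j, m₀ ≤ M j ∧ M j ≤ m₀⁻¹ ∧ |a j| ≤ χ * M j) ∧ ∃ (ε : ℕ → ENNReal) (R : ℕ → ℝ) (O : Set 𝒟.carrier) (c : ∀ n : ℕ, ApproximateKerrConfiguration 𝒟.toSpacetime O 2 (ε n) 0 1 (R n)), Tendsto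 ε atTop (𝓝 0) ∧ Tendsto R atTop atTop ∧ (∀ n, (c n).N = N) ∧ (∀ n (i : Fin (c n).N), m₀ ≤ (c n).mass i ∧ (c n).mass i ≤ m₀⁻¹ ∧ |(c n).spin i| ≤ χ * (c n).mass i) ∧ (∀ n, (c (n + 1)).certifiedSlab 0 ⊆ (c n).windowImage) ∧ (∀ K : Set 𝒟.carrier, IsCompact K → ∃ n₀ : ℕ, ∀ n, n₀ ≤ n → Disjoint (c n).windowImage (𝒟.metric.causalPast 𝒟.timeOrientation K)) ∧ O = 𝒟.toCauchyDevelopment.exteriorOf (⋃ n, (c n).windowImage) ∧ O ⊆ 𝒟.metric.causalPast 𝒟.timeOrientation ((c 0).certifiedSlab 0) ∪ ⋃ n, (c n).windowImage ∧ (∀ n, ∀ σ ∈ Set.Icc (0 : ℝ) (1 / 2), (c (n + 1)).certifiedSlab σ ⊆ (c n).windowImage) ∧ (∀ n (i : Fin (c n).N), ∀ x ∈ (boostedKerrBackground ((c n).motion i).1 ((c n).motion i).2 ((c n).mass i) ((c n).spin i)).truncWindow 0 1 (R n), 𝒟.toSpacetime.timeOrientation.IsFutureDirected (mfderiv 𝓘(ℝ,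 E4) (𝓡 4) ((c n).chart i) x ((((c n).motion i).1 : E4 ≃L[ℝ] E4) (Kerr.timeVector ((c n).mass i) ((c n).spin i) (poincareInv ((c n).motion i).1 ((c n).motion i).2 (x : E4)))))) ∧ (∀ n, ∀ x ∈ (Minkowski.backgroundOn (c n).flatDomain).window 0 1, 𝒟.toSpacetime.timeOrientation.IsFutureDirected (mfderiv 𝓘(ℝ, E4) (𝓡 4) (c n).flatChart x (E4.basisVector 0))) ∧ ∀ δ : ℝ, 0 < δ → ∃ n₀ : ℕ, ∀ n, n₀ ≤ n → ∀ (i : Fin (c n).N) (j : Fin N), (i : ℕ) = (j : ℕ) → |(c n).mass i - M j| ≤ δ ∧ |(c n).spin i - a j| ≤ δ ∧ ‖((((c n).motion i).1 : E4 ≃L[ℝ] E4) : E4 →L[ℝ] E4) - (((Λ j : E4 ≃L[ℝ] E4)) : E4 →L[ℝ] E4)‖ ≤ δ := by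
  intro N m₀ χ hN hm₁ hm₀ hχ₀ hχ₁ X _ _ _ _ _ _ D hD 𝒟 hmax hscri htrack
  obtain ⟨ε, R, O, c, hε, hRt, hcN, hM, hch, hex, hO, hcov, hfat, hfwK, hfwF, hcauchy⟩ :=
    h₁ N m₀ χ hN hm₁ hm₀ hχ₀ hχ₁ X D hD 𝒟 hmax hscri htrack
  obtain ⟨M, a, Λ, hbox, hpin⟩ :=
    _root_.Summit.FinalStateConjecture.FinalStateConjecture.Theorems.RenormalisedDrift.DriftCapture.exists_pinned_of_cauchyLabels
      c N m₀ χ hcN hM hcauchy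
  exact ⟨M, a, Λ, hbox, ε, R, O, c, hε, hRt, hcN, hM, hch, hex, hO, hcov, hfat, hfwK, hfwF, hpin⟩

/-- **ASSEMBLE on the live multi-hole range, v10 (derived)**: forward chain → same-family pin → glue → package (landed
`decomposition_of_unflooredLateCharts`, p158178). -/
theorem globalGaugePos_of_stubs_v10 (h₁ : Sig.stub_forwardSharpChain) (h₃ : Sig.stub_glueForwardChain) :
    ∀ (N : ℕ) (m₀ χ : ℝ), 0 < N → m₀ ≤ 1 → 0 < m₀ → 0 ≤ χ → χ < 1 → ∀ (X : Type) [TopologicalSpace X] [ChartedSpace E3 X] [IsManifold (𝓡 3) ((⊤ : ℕ∞) : WithTop ℕ∞) X] [T2Space X] [SecondCountableTopology X] [ConnectedSpace X], ∀ D ∈ admissibleVacuumData X, ∀ 𝒟 : VacuumCauchyDevelopment D, 𝒟.IsMaximal → Summit.FinalStateConjecture.HasCompleteNullInfinity 𝒟.toCauchyDevelopment → (∀ (L : ℝ) (ε : ENNReal) (R₀ : ℝ), 0 < L → 0 < ε → 𝒟.IsAdiabaticallyTracked N m₀ χ ε L R₀) → ∃ (M a : Fin N → ℝ) (O' : Set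 𝒟.carrier) (d : FinalStateDecomposition 𝒟.toSpacetime O' 2),
        (∀ j, m₀ ≤ M j ∧ M j ≤ m₀⁻¹ ∧ |a j| ≤ χ * M j) ∧ d.N = N ∧
        (∀ (i : Fin d.N) (j : Fin N), (i : ℕ) = (j : ℕ) → d.mass i = M j ∧ d.spin i = a j) ∧
        O' = Summit.FinalStateConjecture.exteriorOf 𝒟.toCauchyDevelopment d.charted ∧
        Summit.FinalStateConjecture.HasExhaustiveCharts d ∧ Summit.FinalStateConjecture.IsFutureOriented d := by
  intro N m₀ χ hN hm₁ hm₀ hχ₀ hχ₁ X _ _ _ _ _ _ D hD 𝒟 hmax hscri htrack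
  obtain ⟨M, a, Λ, hbox, hpin⟩ :=
    pinnedForwardChain_of_stubs h₁ N m₀ χ hN hm₁ hm₀ hχ₀ hχ₁ X D hD 𝒟 hmax hscri htrack
  have hMpos : ∀ j, 0 < M j := fun j ↦ hm₀.trans_le (hbox j).1
  have ha : ∀ j, |a j| ≤ M j := fun j ↦
    (hbox j).2.2.trans (mul_le_of_le_one_left (hMpos j).le hχ₁.le)
  obtain ⟨O', mo, τ₀, Ψ, ρ, U₀, Φ, R, hO', hlate, hsep, hexc, hdom, hflat, hdev, hR, htrunc, hcov, hfutK, hfutF⟩ :=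
    h₃ N m₀ χ hN hm₁ hm₀ hχ₀ hχ₁ X D hD 𝒟 hmax hscri M a Λ hbox hpin
  obtain ⟨d, hdN, hlab, hO'', hexh, hfut⟩ :=
    _root_.Summit.FinalStateConjecture.FinalStateConjecture.Theorems.RenormalisedDrift.DriftCapture.decomposition_of_unflooredLateCharts
      𝒟.toCauchyDevelopment N M a hMpos ha O' mo τ₀ Ψ ρ U₀ Φ R hO' hlate hsep hexc hdom hflat hdev hR htrunc hcov hfutK hfutF
  exact ⟨M, a, O', d, hbox, hdN, hlab, hO'', hexh, hfut⟩

/-- **THE CRUX BY NAME from the v10 stubs**, through the monolithic CENSOR legend: forward engine, FLAT (unoriented; orientation by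
p165980), GLUE (forward chain), CENSOR. Case split as in `DriftCapture_of`. -/
theorem DriftCapture_of_v10' (h₁ : Sig.stub_forwardSharpChain) (h₀ : Sig.stub_flatChartOfTrackingUnoriented)
    (h₃ : Sig.stub_glueForwardChain) (h₄ : Sig.stub_settledExteriorHoldsRays) :
    Summit.FinalStateConjecture.FinalStateConjecture.Theses.RenormalisedDrift.DriftCapture := by
  intro N m₀ χ hm₀ hχ₀ hχ₁ X _ _ _ _ _ _ D hD 𝒟 hmax hscri htrack
  rcases Nat.eq_zero_or_pos N with rfl | hN
  · -- dispersal: unoriented flat late chart, oriented by p165980, packaged by p148929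
    have h₀' : Sig.stub_flatLateChartOfTracking :=
      _root_.Summit.FinalStateConjecture.FinalStateConjecture.Theorems.RenormalisedDrift.DriftCapture.stub_flatLateChartOfTracking_of_unoriented h₀
    obtain ⟨O', d, hdN, -, hO', hexh, hfut⟩ :=
      _root_.Summit.FinalStateConjecture.FinalStateConjecture.Theorems.RenormalisedDrift.DriftCapture.globalGauge_zero_of_flatLateChart
        h₀' m₀ χ hm₀ hχ₀ hχ₁ X D hD 𝒟 hmax hscri Fin.elim0 Fin.elim0 Fin.elim0 (fun j ↦ j.elim0)
        (fun δ _ L ε R₀ hL hε ↦ by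
          obtain ⟨R, O, c, hR, hRt, hcN, hM, hch, hex, hO, hcov⟩ := htrack L ε R₀ hL hε
          exact ⟨R, O, c, hR, hRt, hcN, hM, fun n i j _ ↦ j.elim0, hch, hex, hO, hcov⟩)
    have hsub : ∀ i, Kerr.IsSubextremal (d.mass i) (d.spin i) := fun i ↦
      (Fin.cast hdN i).elim0
    exact ⟨O', d, hsub, hO', h₄ X D hD 𝒟 hmax hscri O' d hsub hO' hexh hfut, hexh, hfut⟩
  · rcases le_or_gt m₀ 1 with hm₁ | hlt
    · -- live multi-hole range
      obtain ⟨M, a, O', d, hbox, hdN, hlab, hO', hexh, hfut⟩ :=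
        globalGaugePos_of_stubs_v10 h₁ h₃ N m₀ χ hN hm₁ hm₀ hχ₀ hχ₁ X D hD 𝒟 hmax hscri htrack
      have hsub : ∀ i, Kerr.IsSubextremal (d.mass i) (d.spin i) := fun i ↦ by
        have hi : (i : ℕ) < N := i.isLt.trans_eq hdN
        obtain ⟨hM, ha⟩ := hlab i ⟨i, hi⟩ rfl
        obtain ⟨h1, -, h3⟩ := hbox ⟨i, hi⟩
        have hMpos : 0 < M ⟨i, hi⟩ := hm₀.trans_le h1
        show |d.spin i| < d.mass i
        rw [hM, ha]
        calc |a ⟨i, hi⟩| ≤ χ * M ⟨i, hi⟩ := h3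
          _ < 1 * M ⟨i, hi⟩ := mul_lt_mul_of_pos_right hχ₁ hMpos
          _ = M ⟨i, hi⟩ := one_mul _
      exact ⟨O', d, hsub, hO', h₄ X D hD 𝒟 hmax hscri O' d hsub hO' hexh hfut, hexh, hfut⟩
    · -- degenerate range: the seam is unsatisfiable
      exact absurd (htrack 1 1 0 one_pos one_pos)
        (_root_.Summit.FinalStateConjecture.FinalStateConjecture.Theorems.RenormalisedDrift.DriftCapture.not_isAdiabaticallyTracked_of_one_lt
          𝒟 hN hlt)

/-- **THE CRUX BY NAME from the v10 stub list** (forward engine, FLAT unoriented, GLUE forward, CENSOR-S, CENSOR-N). -/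
theorem DriftCapture_of_v10 :
    Sig.stub_forwardSharpChain → Sig.stub_flatChartOfTrackingUnoriented → Sig.stub_glueForwardChain →
      Sig.stub_chartsShadowEndVisibleRegion → Sig.stub_noHiddenCompleteRays →
      Summit.FinalStateConjecture.FinalStateConjecture.Theses.RenormalisedDrift.DriftCapture :=
  fun h₁ h₀ h₃ hS hN ↦ DriftCapture_of_v10' h₁ h₀ h₃ (censor_of_SN hS hN)

/-- **THE CRUX BY NAME from the v9 stub list** (FREEZE engine, pin, FLAT, GLUE, CENSOR-S, CENSOR-N). -/
theorem DriftCapture_of_v9 :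
    Sig.stub_sharpTrackingChain → Sig.stub_pinnedOfCauchyChain → Sig.stub_flatLateChartOfTracking →
      Sig.stub_glueSharpChain → Sig.stub_chartsShadowEndVisibleRegion → Sig.stub_noHiddenCompleteRays →
      Summit.FinalStateConjecture.FinalStateConjecture.Theses.RenormalisedDrift.DriftCapture :=
  fun h₁ h₂ h₀ h₃ hS hN ↦ DriftCapture_of h₁ h₂ h₀ h₃ (censor_of_SN hS hN)

/-- The crux by name, closed modulo the registered stubs (v10: forward engine, FLAT unoriented, GLUE forward, CENSOR-S, CENSOR-N; the
same-family pin, the v9 engine/FLAT forms and the monolithic CENSOR are derived in-file). -/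
theorem driftCapture_of_stubs : Summit.FinalStateConjecture.FinalStateConjecture.Theses.RenormalisedDrift.DriftCapture :=
  -- v10 registered stubs: forward engine, FLAT unoriented, GLUE forward, CENSOR-S, CENSOR-N
  DriftCapture_of_v10 stub_forwardSharpChain stub_flatChartOfTrackingUnoriented stub_glueForwardChain
    stub_chartsShadowEndVisibleRegion stub_noHiddenCompleteRays

/-- The same closure through the monolithic-CENSOR route (consistency; elaborated, kept). -/
example : Summit.FinalStateConjecture.FinalStateConjecture.Theses.RenormalisedDrift.DriftCapture :=
  DriftCapture_of_v10' stub_forwardSharpChain stub_flatChartOfTrackingUnoriented stub_glueForwardChain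
    stub_settledExteriorHoldsRays

end Summit.FinalStateConjecture.FinalStateConjecture.Cruxes.DriftCapture.Birth
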